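import Literature.Probability.LatticeModels.DisagreementPercolationCoupling
import Literature.Probability.LatticeModels.GlauberTwoBlockGap
import HarnessLib

/-!
# The Dobrushin–Shlosman «surgery» coupling along an increasing sequence of scales ([MOS94] §2), PROVED

Topic `Literature/Probability/LatticeModels`; cell `ym-ir`, seat lit-3 (census row B2 «weak mixing ⇒ strong
mixing in two dimensions»).  THEOREMS ONLY (D-0026): this file is the finite, model-independent core of the
proof of [MOS94] Proposition 2.1 (F. Martinelli, E. Olivieri, R. H. Schonmann, *For 2-D lattice spin systems
weak mixing implies strong mixing*, Commun. Math. Phys. 165 (1994) 33–47, §2 p0006 L25 – p0009 L8), written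
for the finite-volume Gibbs distributions `U.spec β` of a finite-range potential with FINITE single-spin
space in ANY dimension; the two-dimensional geometry (the rings around a boundary site of a square, the
«at most one bad scale» count and the weak-mixing estimate (a)) is supplied separately and plugged into the
abstract hypotheses `Scheme.good` below.

## The construction ([MOS94] p0006 L40 – p0008, «surgery technique (used for instance in [DS1])»)

Fix a finite volume `Λ`, two boundary conditions `τ, τ′` and the pair space `(Λ → S) × (Λ → S)` (first
copy glued to `τ`, second to `τ′` off `Λ`).  A COUPLING is a non-negative function `ν` on pairs whose
marginals are the fibre weights `wt (U.spec β) Λ τ`, `wt (U.spec β) Λ τ′` (F10's `DisagreementCoupling.wt`).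
* SURGERY on `Γ ⊆ Λ` with a «mark set» `M ⊆ Γ` (`stepKernel`): resample the `Γ`-part of both copies from
  their conditional laws `μ_Γ^{(η τ)}`, `μ_Γ^{(ξ τ′)}` (`rk`), coupling the two laws of the `M`-restriction
  OPTIMALLY (F10's `copt`, mass `min(q, q′)` on the diagonal) and completing independently given the
  `M`-part.  Its marginals are the two resampling kernels (`sum_stepKernel_snd/fst`), so by the DLR
  equations in fibre-weight form (`sum_wt_rk`, from `DisagreementCovariance.weight_factor`) the new pair
  function is again a coupling (`IsCoupling.step`) — [MOS94] (2.4)–(2.5).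
* The probability that the resampled copies DISAGREE somewhere on `M` is exactly the total variation of the
  two `M`-marginals (`sum_stepKernel_disagree_le`).  Two uses: (G) if the inputs agree on a set `D ⊇ ∂_r^+Γ ∩ Λ`
  and `τ = τ′` on `∂_r^+Γ ∖ Λ`, the two conditional laws on `Γ` COINCIDE (finite-range Markov property,
  `rk_eq_of_agr`), so with `M = Γ` the outputs agree on all of `Γ` ([MOS94] (2.7)); (B) otherwise, with
  `M = D′ = B ∪ A` the next ring, the agreement probability is at least
  `(1 − ‖marginals on B‖) · e^{−c(|A|)}` (`one_sub_tvd_ge`): total variation on the part `B` far from `∂Λ`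
  (to be fed by weak mixing) times a finite-energy factor for the part `A` of bounded size near `∂Λ`
  (`spec_real_cyl_ge_mul`, from the atom bound `spec_real_glue_ge`) — [MOS94] (2.8)–(2.10).
* ITERATION (`Scheme`, `coupling`): volumes `Γ_1 ⊇ Γ_2 ⊇ … ⊇ Γ_k` with rings `D_i ⊇ ∂_r^+Γ_i ∩ Λ`,
  `D_{i+1} ⊆ Γ_i`; at step `i` the mark set is `Γ_i` for pairs agreeing on `D_i` and `D_{i+1}` otherwise.  The
  mass of pairs NOT agreeing on `D_{i+1}` contracts by `1 − δ` at every GOOD step and never increases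
  (`mass_notAgr_step_le`), whence the final estimate `|μ_Λ^τ(E) − μ_Λ^{τ′}(E)| ≤ (1 − δ)^{#good}` for every
  event `E` of the spins in `Γ_k` (`abs_sub_le_pow_of_scheme`) — [MOS94] (2.11)–(2.12).

Deviation from print (bookkeeping only): [MOS94] realise step (B) as the composition of a weak-mixing
coupling on `B` with the PRODUCT surgery on `A` ((2.9)); we use the single optimal coupling of the
`(B ∪ A)`-marginals and bound its diagonal mass below by the same product `(1 − Var_B) · e^{−c|A|}`
(elementary: `min(q₁(b,a), q₂(b,a)) ≥ ε · min(q₁^B b, q₂^B b)` when every pattern on `A` has conditional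
probability `≥ ε`).  Same constants up to the value of `c`.

References: [MOS94] §2 [cite: MartinelliOlivieriSchonmann1994, Proposition 2.1 (proof)]; the surgery
technique [DS1] = Dobrushin–Shlosman 1985 (not held, acq-09935) as described in [MOS94] p0006 L40 – p0007
L30.  SIBLING-SETTING result (classical finite-range lattice spin systems); nothing here concerns gauge
theories; the Yang–Mills mass gap (Clay) is NOT touched (R4 closes only the conditional finite-𝕋⁴ rung
`BalabanLadder.UV`).
-/

open MeasureTheory Finset

noncomputable section

namespace Literature.Probability.LatticeModels

namespace BoundarySurgery

open DisagreementCoupling DisagreementCovariance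

universe v

variable {d : ℕ} {S : Type v} [MeasurableSpace S] [MeasurableSingletonClass S] [Fintype S] [Nonempty S]
  [DecidableEq S] {r : ℕ}

open scoped Classical

/-! ### Cylinders, restrictions, splicing -/

/-- The cylinder of configurations with prescribed values `m` on the finite set `M`. [folklore] -/
def cyl (M : Finset (Site d)) (m : ↥M → S) : Set (Site d → S) := {σ | ∀ x : ↥M, σ x = m x}

omit [MeasurableSpace S] [MeasurableSingletonClass S] [Fintype S] [Nonempty S] [DecidableEq S] in
/-- Membership in a cylinder. [folklore] -/
private theorem mem_cyl {M : Finset (Site d)} {m : ↥M → S} {σ : Site d → S} : σ ∈ cyl M m ↔ ∀ x : ↥M, σ x = m x :=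
  Iff.rfl

omit [Fintype S] [Nonempty S] [DecidableEq S] in
/-- Cylinders are measurable. [folklore] -/
private theorem measurableSet_cyl (M : Finset (Site d)) (m : ↥M → S) : MeasurableSet (cyl M m) := by
  have : cyl M m = ⋂ x : ↥M, (fun σ : Site d → S => σ x) ⁻¹' {m x} := by
    ext σ; simp [cyl]
  rw [this]
  exact MeasurableSet.iInter fun x => measurable_pi_apply (x : Site d) (measurableSet_singleton _)

omit [MeasurableSpace S] [MeasurableSingletonClass S] [Fintype S] [Nonempty S] [DecidableEq S] in
/-- A cylinder over `M` is an `M`-local event. [folklore] -/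
private theorem dependsOn_cyl (M : Finset (Site d)) (m : ↥M → S) : DependsOn (· ∈ cyl M m) (↑M : Set (Site d)) := by
  intro σ σ' h
  simp only [eq_iff_iff]
  exact ⟨fun hσ x => (h x.1 (Finset.mem_coe.2 x.2)).symm.trans (hσ x),
    fun hσ x => (h x.1 (Finset.mem_coe.2 x.2)).trans (hσ x)⟩

/-- Restriction of an `N`-configuration to `M` (junk off `N`; used for `M ⊆ N`). [folklore] -/
def res (M : Finset (Site d)) {N : Finset (Site d)} (ρ : ↥N → S) : ↥M → S :=
  fun x => if hx : (x : Site d) ∈ N then ρ ⟨x, hx⟩ else Classical.arbitrary S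

omit [MeasurableSpace S] [MeasurableSingletonClass S] [Fintype S] [DecidableEq S] in
/-- Value of the restriction inside `N`. [folklore] -/
private theorem res_apply {M N : Finset (Site d)} (ρ : ↥N → S) (x : ↥M) (hx : (x : Site d) ∈ N) :
    res M ρ x = ρ ⟨x, hx⟩ := by
  simp [res, hx]

/-- Replace the `Γ`-part of a `Λ`-configuration by `ρ`. [cite: MartinelliOlivieriSchonmann1994, §2 (2.4)] -/
def splice {Λ Γ : Finset (Site d)} (ζ : ↥Λ → S) (ρ : ↥Γ → S) : ↥Λ → S :=
  fun x => if hx : (x : Site d) ∈ Γ then ρ ⟨x, hx⟩ else ζ x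

omit [MeasurableSpace S] [MeasurableSingletonClass S] [Fintype S] [Nonempty S] [DecidableEq S] in
/-- The spliced configuration on `Γ`. [folklore] -/
private theorem splice_apply_of_mem {Λ Γ : Finset (Site d)} (ζ : ↥Λ → S) (ρ : ↥Γ → S) {x : ↥Λ}
    (hx : (x : Site d) ∈ Γ) : splice ζ ρ x = ρ ⟨x, hx⟩ := by
  simp [splice, hx]

omit [MeasurableSpace S] [MeasurableSingletonClass S] [Fintype S] [Nonempty S] [DecidableEq S] in
/-- The spliced configuration off `Γ`. [folklore] -/
private theorem splice_apply_of_not_mem {Λ Γ : Finset (Site d)} (ζ : ↥Λ → S) (ρ : ↥Γ → S) {x : ↥Λ}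
    (hx : (x : Site d) ∉ Γ) : splice ζ ρ x = ζ x := by
  simp [splice, hx]

omit [MeasurableSpace S] [MeasurableSingletonClass S] [Fintype S] [DecidableEq S] in
/-- `splice ζ ρ = ζ′` iff `ρ` is the `Γ`-part of `ζ′` and `ζ, ζ′` agree off `Γ` (`Γ ⊆ Λ`). [folklore] -/
private theorem splice_eq_iff {Λ Γ : Finset (Site d)} (hΓ : Γ ⊆ Λ) (ζ ζ' : ↥Λ → S) (ρ : ↥Γ → S) :
    splice ζ ρ = ζ' ↔ ρ = res Γ ζ' ∧ Agr (Λ \ Γ) ζ ζ' := by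
  constructor
  · rintro rfl
    refine ⟨?_, fun x hx => ?_⟩
    · funext x
      rw [res_apply _ _ (hΓ x.2), splice_apply_of_mem ζ ρ (x := ⟨x, hΓ x.2⟩) x.2]
    · exact (splice_apply_of_not_mem ζ ρ (Finset.mem_sdiff.1 hx).2).symm
  · rintro ⟨rfl, hA⟩
    funext x
    by_cases hx : (x : Site d) ∈ Γ
    · rw [splice_apply_of_mem ζ _ hx, res_apply ζ' ⟨(x : Site d), hx⟩ x.2]
    · rw [splice_apply_of_not_mem ζ _ hx]
      exact hA x (Finset.mem_sdiff.2 ⟨x.2, hx⟩)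

omit [MeasurableSpace S] [MeasurableSingletonClass S] [Fintype S] [Nonempty S] [DecidableEq S] in
/-- Gluing a spliced configuration: on `Γ` it reads `ρ`. [folklore] -/
private theorem glueWith_splice_apply_of_mem {Λ Γ : Finset (Site d)} (hΓ : Γ ⊆ Λ) (ζ : ↥Λ → S) (ρ : ↥Γ → S)
    (θ : Site d → S) {x : Site d} (hx : x ∈ Γ) : glueWith Λ (splice ζ ρ) θ x = ρ ⟨x, hx⟩ := by
  rw [glueWith_apply_mem Λ _ θ (hΓ hx), splice_apply_of_mem ζ ρ hx]

omit [MeasurableSpace S] [MeasurableSingletonClass S] [Fintype S] [Nonempty S] [DecidableEq S] in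
/-- Gluing a spliced configuration: off `Γ` it reads the glued `ζ`. [folklore] -/
private theorem glueWith_splice_apply_of_not_mem {Λ Γ : Finset (Site d)} (ζ : ↥Λ → S) (ρ : ↥Γ → S)
    (θ : Site d → S) {x : Site d} (hx : x ∉ Γ) : glueWith Λ (splice ζ ρ) θ x = glueWith Λ ζ θ x := by
  by_cases hxΛ : x ∈ Λ
  · rw [glueWith_apply_mem Λ _ θ hxΛ, glueWith_apply_mem Λ _ θ hxΛ, splice_apply_of_not_mem ζ ρ hx]
  · rw [glueWith_apply_not_mem Λ _ θ hxΛ, glueWith_apply_not_mem Λ _ θ hxΛ]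

/-! ### The atom bound for finite spin spaces ([Mar99] Prop. 3.9's «trivial estimate», general `S`) -/

section Atoms

variable (U : FRPotential d S r) (β : ℝ)

omit [MeasurableSingletonClass S] [Fintype S] [Nonempty S] [DecidableEq S] in
/-- `|H_Λ(σ)| ≤ C 2^{n(2r+1)^d}` for `|Λ| ≤ n` when `|U_X| ≤ C` for all `X` (general finite `S`; the `±1`
case is `Glauber.abs_hamiltonianIn_le_pow`). [cite: Martinelli1999, Proposition 3.9, proof] -/
theorem abs_hamiltonianIn_le_pow {C : ℝ} (hC0 : 0 ≤ C) (hC : ∀ (X : Finset (Site d)) (σ : Site d → S), |U.U X σ| ≤ C)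
    {Λ : Finset (Site d)} {n : ℕ} (hn : Λ.card ≤ n) (σ : Site d → S) :
    |hamiltonianIn U.U (interactionSets r) Λ σ| ≤ C * 2 ^ (n * (2 * r + 1) ^ d) := by
  have h1 := abs_hamiltonianIn_le (Φ := U.U) (C := fun _ => C) (fun A σ => hC A σ) (interactionSets r) Λ σ
  refine h1.trans ?_
  rw [Finset.sum_const, nsmul_eq_mul, mul_comm]
  refine mul_le_mul_of_nonneg_left ?_ hC0
  have h2 : ((interactionSets r Λ).filter fun A => (A ∩ Λ).Nonempty).card ≤ (interactionSets r Λ).card :=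
    Finset.card_filter_le _ _
  have h3 : (interactionSets r Λ).card ≤ ((Λ.biUnion fun y => rNeighbourhood r y).powerset).card := by
    unfold interactionSets; exact Finset.card_filter_le _ _
  rw [Finset.card_powerset] at h3
  have h4 : (Λ.biUnion fun y => rNeighbourhood r y).card ≤ n * (2 * r + 1) ^ d := by
    refine Finset.card_biUnion_le.trans ?_
    rw [Finset.sum_const_nat (m := (2 * r + 1) ^ d) fun y _ => card_rNeighbourhood r y]
    exact Nat.mul_le_mul_right _ hn
  have h5 : 2 ^ (Λ.biUnion fun y => rNeighbourhood r y).card ≤ 2 ^ (n * (2 * r + 1) ^ d) :=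
    Nat.pow_le_pow_right (by norm_num) h4
  exact_mod_cast h2.trans (h3.trans h5)

omit [MeasurableSingletonClass S] [Nonempty S] [DecidableEq S] in
/-- The a priori measure `count^{⊗Λ}` on `S^Λ` has total mass `|S|^{|Λ|}`. [folklore] -/
private theorem pi_count_univ (Λ : Finset (Site d)) :
    (Measure.pi fun _ : ↥Λ => (Measure.count : Measure S)) Set.univ = (Fintype.card S : ENNReal) ^ Λ.card := by
  rw [Measure.pi_univ]
  simp only [Measure.count_univ, ENat.card_eq_coe_fintype_card, Finset.prod_const, Finset.card_univ,
    Fintype.card_coe]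
  norm_cast

/-- The atom lower bound `ε(n) = e^{−2|β| C 2^{n(2r+1)^d}} |S|^{−n}`. [cite: Martinelli1999, Proposition 3.9, proof] -/
def atomLB (β C : ℝ) (r d : ℕ) (cardS n : ℕ) : ℝ :=
  Real.exp (-(2 * (|β| * (C * 2 ^ (n * (2 * r + 1) ^ d))))) * ((cardS : ℝ) ^ n)⁻¹

omit [MeasurableSpace S] [MeasurableSingletonClass S] [Fintype S] [Nonempty S] [DecidableEq S] in
/-- `ε(n) > 0` (for a non-empty spin space). [cite: Martinelli1999, Proposition 3.9, proof] -/
theorem atomLB_pos (β C : ℝ) (r d : ℕ) {cardS : ℕ} (h : 0 < cardS) (n : ℕ) : 0 < atomLB β C r d cardS n :=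
  mul_pos (Real.exp_pos _) (inv_pos.2 (pow_pos (by exact_mod_cast h) _))

omit [MeasurableSpace S] [MeasurableSingletonClass S] [Fintype S] [Nonempty S] [DecidableEq S] in
/-- `ε(n) ≤ 1` when `C ≥ 0` and `|S| ≥ 1`. [cite: Martinelli1999, Proposition 3.9, proof] -/
theorem atomLB_le_one (β : ℝ) {C : ℝ} (hC : 0 ≤ C) (r d : ℕ) {cardS : ℕ} (h : 0 < cardS) (n : ℕ) :
    atomLB β C r d cardS n ≤ 1 := by
  unfold atomLB
  have h1 : Real.exp (-(2 * (|β| * (C * 2 ^ (n * (2 * r + 1) ^ d))))) ≤ 1 :=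
    Real.exp_le_one_iff.2 (neg_nonpos.2 (by positivity))
  have h2 : ((cardS : ℝ) ^ n)⁻¹ ≤ 1 :=
    inv_le_one_of_one_le₀ (one_le_pow₀ (by exact_mod_cast h))
  exact mul_le_one₀ h1 (inv_nonneg.2 (pow_nonneg (by positivity) _)) h2

omit [MeasurableSpace S] [MeasurableSingletonClass S] [Fintype S] [Nonempty S] [DecidableEq S] in
/-- `ε` is antitone in `n` (for `C ≥ 0`, `|S| ≥ 1`). [cite: Martinelli1999, Proposition 3.9, proof] -/
theorem atomLB_anti (β : ℝ) {C : ℝ} (hC : 0 ≤ C) (r d : ℕ) {cardS : ℕ} (h : 0 < cardS) {n n' : ℕ}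
    (hn : n ≤ n') : atomLB β C r d cardS n' ≤ atomLB β C r d cardS n := by
  unfold atomLB
  have hS1 : (1 : ℝ) ≤ cardS := by exact_mod_cast h
  refine mul_le_mul ?_ ?_ (inv_nonneg.2 (pow_nonneg (by positivity) _)) (Real.exp_pos _).le
  · refine Real.exp_le_exp.2 (neg_le_neg ?_)
    have : (2 : ℝ) ^ (n * (2 * r + 1) ^ d) ≤ 2 ^ (n' * (2 * r + 1) ^ d) :=
      pow_le_pow_right₀ one_le_two (Nat.mul_le_mul_right _ hn)
    exact mul_le_mul_of_nonneg_left (mul_le_mul_of_nonneg_left (mul_le_mul_of_nonneg_left this hC)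
      (abs_nonneg β)) zero_le_two
  · exact inv_anti₀ (pow_pos (by positivity) _) (pow_le_pow_right₀ hS1 hn)

omit [DecidableEq S] in
set_option maxHeartbeats 800000 in
/-- **The atom bound** ([Mar99] Prop. 3.9, proof, «a trivial estimate on `inf_σ μ_Λ^τ(σ)`», general finite
`S`): every configuration equal to `τ` off `Λ` has `μ_Λ^τ`-mass at least `ε(n)` when `|Λ| ≤ n` and
`|U_X| ≤ C`. [cite: Martinelli1999, Proposition 3.9, proof] -/
theorem spec_real_glue_ge {C : ℝ} (hC0 : 0 ≤ C) (hC : ∀ (X : Finset (Site d)) (σ : Site d → S), |U.U X σ| ≤ C)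
    {Λ : Finset (Site d)} {n : ℕ} (hn : Λ.card ≤ n) (τ : Site d → S) (κ : ↥Λ → S) :
    atomLB β C r d (Fintype.card S) n ≤ (U.spec β Λ τ).real {glueWith Λ κ τ} := by
  have hγ := U.isSpecification_spec β
  haveI := hγ.isProbability Λ τ
  set H := hamiltonianIn U.U (interactionSets r) Λ with hH
  set φ : (Site d → S) → ℝ := fun σ => -β * H σ with hφ
  set π : Measure (Site d → S) :=
    (Measure.pi fun _ : ↥Λ => (Measure.count : Measure S)).map (glueWith Λ · τ) with hπ
  have hμ : U.spec β Λ τ = π.tilted φ := rfl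
  set Cφ : ℝ := |β| * (C * 2 ^ (n * (2 * r + 1) ^ d)) with hCφ
  have hφb : ∀ σ, |φ σ| ≤ Cφ := fun σ => by
    simp only [hφ]
    rw [abs_mul, abs_neg]
    exact mul_le_mul_of_nonneg_left (abs_hamiltonianIn_le_pow U hC0 hC hn σ) (abs_nonneg β)
  have hφm : Measurable φ := (measurable_hamiltonianIn (fun A => (U.adapted A).2) _ Λ).const_mul _
  haveI : NeZero π := ⟨map_glueWith_pi_ne_zero Measure.count (NeZero.ne _) Λ τ⟩
  haveI : IsFiniteMeasure π := by rw [hπ]; infer_instance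
  have hS0 : (0 : ℝ) < Fintype.card S := by exact_mod_cast Fintype.card_pos
  have hπuniv : π Set.univ = (Fintype.card S : ENNReal) ^ Λ.card := by
    rw [hπ, Measure.map_apply (measurable_glueWith Λ τ) MeasurableSet.univ, Set.preimage_univ]
    exact pi_count_univ Λ
  have hπreal : π.real Set.univ = (Fintype.card S : ℝ) ^ Λ.card := by
    rw [measureReal_def, hπuniv]; simp
  have hint := integrable_exp_map_glueWith_pi (Measure.count : Measure S) Λ τ hφm ⟨Cφ, hφb⟩
  have hZle : ∫ x, Real.exp (φ x) ∂π ≤ Real.exp Cφ * (Fintype.card S : ℝ) ^ Λ.card := by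
    calc ∫ x, Real.exp (φ x) ∂π ≤ ∫ x, Real.exp Cφ ∂π :=
          integral_mono hint (integrable_const _) fun x => Real.exp_le_exp.2 ((le_abs_self _).trans (hφb x))
      _ = π.real Set.univ * Real.exp Cφ := by rw [integral_const, smul_eq_mul]
      _ = Real.exp Cφ * (Fintype.card S : ℝ) ^ Λ.card := by rw [hπreal, mul_comm]
  have hZle' : ∫ x, Real.exp (φ x) ∂π ≤ Real.exp Cφ * (Fintype.card S : ℝ) ^ n :=
    hZle.trans (mul_le_mul_of_nonneg_left (pow_le_pow_right₀ (by exact_mod_cast Fintype.card_pos) hn)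
      (Real.exp_pos _).le)
  have hZpos : 0 < ∫ x, Real.exp (φ x) ∂π := integral_exp_pos hint
  set σ := glueWith Λ κ τ with hσ
  have hπσ : 1 ≤ π {σ} := by
    rw [hπ, Measure.map_apply (measurable_glueWith Λ τ) (measurableSet_singleton σ)]
    have hsub : ({κ} : Set (↥Λ → S)) ⊆ (glueWith Λ · τ) ⁻¹' {σ} := by
      intro ζ hζ
      rw [Set.mem_singleton_iff] at hζ
      rw [Set.mem_preimage, hζ, hσ, Set.mem_singleton_iff]
    calc (1 : ENNReal) = Measure.pi (fun _ : ↥Λ => (Measure.count : Measure S)) {κ} := by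
          rw [Measure.pi_singleton]; simp
      _ ≤ _ := measure_mono hsub
  have hμσ : U.spec β Λ τ {σ} = ENNReal.ofReal (Real.exp (φ σ) / ∫ x, Real.exp (φ x) ∂π) * π {σ} := by
    rw [hμ, tilted_apply' _ _ (measurableSet_singleton σ), lintegral_singleton]
  have hreal : Real.exp (-(2 * Cφ)) * ((Fintype.card S : ℝ) ^ n)⁻¹ ≤ Real.exp (φ σ) / ∫ x, Real.exp (φ x) ∂π := by
    have e : Real.exp (-(2 * Cφ)) * ((Fintype.card S : ℝ) ^ n)⁻¹ =
        Real.exp (-Cφ) / (Real.exp Cφ * (Fintype.card S : ℝ) ^ n) := by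
      rw [eq_div_iff (by positivity), show -(2 * Cφ) = -Cφ + -Cφ by ring, Real.exp_add, Real.exp_neg Cφ]
      field_simp
    rw [e]
    exact div_le_div₀ (Real.exp_pos _).le (Real.exp_le_exp.2 ((neg_abs_le _).trans' (neg_le_neg (hφb σ))))
      hZpos hZle'
  have hlow : ENNReal.ofReal (Real.exp (-(2 * Cφ)) * ((Fintype.card S : ℝ) ^ n)⁻¹) ≤ U.spec β Λ τ {σ} := by
    rw [hμσ]
    calc ENNReal.ofReal (Real.exp (-(2 * Cφ)) * ((Fintype.card S : ℝ) ^ n)⁻¹)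
        ≤ ENNReal.ofReal (Real.exp (φ σ) / ∫ x, Real.exp (φ x) ∂π) := ENNReal.ofReal_le_ofReal hreal
      _ = ENNReal.ofReal (Real.exp (φ σ) / ∫ x, Real.exp (φ x) ∂π) * 1 := (mul_one _).symm
      _ ≤ _ := mul_le_mul' le_rfl hπσ
  unfold atomLB
  rw [measureReal_def]
  exact (ENNReal.ofReal_le_iff_le_toReal (measure_ne_top _ _)).1 hlow

end Atoms

/-! ### Finite sums: regrouping along a restriction map -/

omit [MeasurableSpace S] [MeasurableSingletonClass S] in
/-- Regrouping a sum over `N`-configurations along the restriction to `M`. [folklore] -/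
private theorem sum_mul_res_eq {M N : Finset (Site d)} (g : (↥M → S) → ℝ) (f : (↥N → S) → ℝ) :
    ∑ ρ, g (res M ρ) * f ρ = ∑ m, g m * ∑ ρ, (if res M ρ = m then f ρ else 0) := by
  simp_rw [Finset.mul_sum]
  rw [Finset.sum_comm]
  refine Finset.sum_congr rfl fun ρ _ => ?_
  rw [Finset.sum_eq_single (res M ρ)]
  · simp
  · intro m _ hm
    rw [if_neg (Ne.symm hm), mul_zero]
  · intro h; exact absurd (Finset.mem_univ _) h

omit [MeasurableSpace S] [MeasurableSingletonClass S] [Fintype S] [Nonempty S] [DecidableEq S] in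
/-- Regrouping a double sum along the values of a map (`Σ_{a,b} h(a,b) g(F(a,b)) = Σ_c g(c) Σ_{F(a,b)=c} h(a,b)`).
[folklore] -/
private theorem sum_sum_mul_eq_sum_fiber {α γ δ : Type*} [Fintype α] [Fintype γ] [Fintype δ] [DecidableEq δ]
    (F : α → γ → δ) (h : α → γ → ℝ) (g : δ → ℝ) :
    ∑ a, ∑ b, h a b * g (F a b) = ∑ c, g c * ∑ a, ∑ b, (if F a b = c then h a b else 0) := by
  have key : ∀ a b, h a b * g (F a b) = ∑ c, g c * (if F a b = c then h a b else 0) := by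
    intro a b
    rw [Finset.sum_eq_single (F a b)]
    · rw [if_pos rfl, mul_comm]
    · intro c _ hc; rw [if_neg (Ne.symm hc), mul_zero]
    · intro hh; exact absurd (Finset.mem_univ _) hh
  calc ∑ a, ∑ b, h a b * g (F a b) = ∑ a, ∑ b, ∑ c, g c * (if F a b = c then h a b else 0) := by
        simp_rw [key]
    _ = ∑ a, ∑ c, ∑ b, g c * (if F a b = c then h a b else 0) :=
        Finset.sum_congr rfl fun a _ => Finset.sum_comm
    _ = ∑ c, ∑ a, ∑ b, g c * (if F a b = c then h a b else 0) := Finset.sum_comm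
    _ = ∑ c, g c * ∑ a, ∑ b, (if F a b = c then h a b else 0) := by simp_rw [Finset.mul_sum]

omit [MeasurableSpace S] [MeasurableSingletonClass S] [Fintype S] [DecidableEq S] in
/-- Restricting an extension gives back the pattern (`B ⊆ M`). [folklore] -/
private theorem res_res_of_subset {B M : Finset (Site d)} (hBM : B ⊆ M) (b : ↥B → S) : res B (res M b) = b := by
  funext x
  rw [res_apply _ _ (hBM x.2)]
  exact res_apply b ⟨(x : Site d), hBM x.2⟩ x.2

omit [MeasurableSpace S] [MeasurableSingletonClass S] [DecidableEq S] in
/-- A non-negative sum over `M`-patterns dominates the sum over the extensions of `B`-patterns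
(`B ⊆ M`; the extension map `res M` is injective). [folklore] -/
private theorem sum_ge_sum_res {B M : Finset (Site d)} (hBM : B ⊆ M) {f : (↥M → S) → ℝ} (hf : ∀ m, 0 ≤ f m) :
    ∑ b : ↥B → S, f (res M b) ≤ ∑ m, f m := by
  have hinj : Set.InjOn (fun b : ↥B → S => (res M b : ↥M → S)) ↑(Finset.univ : Finset (↥B → S)) := by
    intro b _ b' _ h
    have := congrArg (res B) h
    simpa [res_res_of_subset hBM] using this
  rw [← Finset.sum_image hinj]
  exact Finset.sum_le_sum_of_subset_of_nonneg (Finset.subset_univ _) fun m _ _ => hf m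

/-! ### Cylinders of a specification kernel: measurability helpers -/

omit [Fintype S] [Nonempty S] [DecidableEq S] in
/-- Cylinders `agreeOn K ξ` are measurable. [folklore] -/
private theorem measurableSet_agreeOn' (K : Finset (Site d)) (ξ : Site d → S) :
    MeasurableSet (agreeOn (S := S) K ξ) := by
  have : agreeOn K ξ = ⋂ x ∈ K, (fun σ : Site d → S => σ x) ⁻¹' {ξ x} := by
    ext σ; simp [agreeOn]
  rw [this]
  exact MeasurableSet.biInter K.countable_toSet fun x _ => measurable_pi_apply x (measurableSet_singleton _)

omit [MeasurableSpace S] [MeasurableSingletonClass S] [Fintype S] [Nonempty S] [DecidableEq S] in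
/-- Cylinders are local. [folklore] -/
private theorem dependsOn_agreeOn' (K : Finset (Site d)) (ξ : Site d → S) :
    DependsOn (· ∈ agreeOn (S := S) K ξ) (↑K : Set (Site d)) := by
  intro σ σ' h
  simp only [eq_iff_iff]
  exact ⟨fun hσ x hx => (h x (Finset.mem_coe.2 hx)).symm.trans (hσ x hx),
    fun hσ x hx => (h x (Finset.mem_coe.2 hx)).trans (hσ x hx)⟩

omit [MeasurableSpace S] [MeasurableSingletonClass S] [Fintype S] [Nonempty S] [DecidableEq S] in
/-- Cylinders depend only on the prescribed values. [folklore] -/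
private theorem agreeOn_congr' {K : Finset (Site d)} {ξ ξ' : Site d → S} (h : ∀ x ∈ K, ξ x = ξ' x) :
    agreeOn (S := S) K ξ = agreeOn K ξ' := by
  ext σ
  exact ⟨fun hσ x hx => (hσ x hx).trans (h x hx), fun hσ x hx => (hσ x hx).trans (h x hx).symm⟩

/-! ### Resampling kernels and their marginals -/

section Kernels

variable (U : FRPotential d S r) (β : ℝ) {Λ : Finset (Site d)}

/-- The RESAMPLING KERNEL of the volume `Γ` for a copy glued to `θ` off `Λ`: the law of the new `Γ`-part,
`ρ ↦ μ_Γ^{(ζ θ)}(σ_Γ = ρ)` (fibre weights of `μ_Γ` at the boundary condition `glueWith Λ ζ θ`).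
[cite: MartinelliOlivieriSchonmann1994, §2 (2.4)–(2.5)] -/
def rk (θ : Site d → S) (Γ : Finset (Site d)) (ζ : ↥Λ → S) : (↥Γ → S) → ℝ :=
  wt (U.spec β) Γ (glueWith Λ ζ θ)

/-- The `M`-MARGINAL of the resampling kernel: `m ↦ μ_Γ^{(ζ θ)}(σ_M = m)`.
[cite: MartinelliOlivieriSchonmann1994, §2 (2.8)] -/
def qM (θ : Site d → S) (Γ M : Finset (Site d)) (ζ : ↥Λ → S) : (↥M → S) → ℝ :=
  fun m => (U.spec β Γ (glueWith Λ ζ θ)).real (cyl M m)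

omit [MeasurableSingletonClass S] [Fintype S] [Nonempty S] [DecidableEq S] in
/-- Resampling weights are non-negative. [cite: MartinelliOlivieriSchonmann1994, §2 (2.4)] -/
theorem rk_nonneg (θ : Site d → S) (Γ : Finset (Site d)) (ζ : ↥Λ → S) (ρ : ↥Γ → S) :
    0 ≤ rk U β θ Γ ζ ρ :=
  wt_nonneg _ _ _ _

omit [DecidableEq S] in
/-- Resampling weights sum to one. [cite: MartinelliOlivieriSchonmann1994, §2 (2.4)] -/
theorem sum_rk (θ : Site d → S) (Γ : Finset (Site d)) (ζ : ↥Λ → S) : ∑ ρ, rk U β θ Γ ζ ρ = 1 :=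
  sum_wt (U.isSpecification_spec β) Γ _

omit [MeasurableSingletonClass S] [Fintype S] [Nonempty S] [DecidableEq S] in
/-- Marginal weights are non-negative. [cite: MartinelliOlivieriSchonmann1994, §2 (2.8)] -/
theorem qM_nonneg (θ : Site d → S) (Γ M : Finset (Site d)) (ζ : ↥Λ → S) (m : ↥M → S) :
    0 ≤ qM U β θ Γ M ζ m :=
  measureReal_nonneg

/-- The `M`-marginal is the push-forward of the resampling kernel under restriction (`M ⊆ Γ`).
[cite: MartinelliOlivieriSchonmann1994, §2 (2.8)] -/
theorem sum_rk_ite_eq_qM {Γ M : Finset (Site d)} (hM : M ⊆ Γ) (θ : Site d → S) (ζ : ↥Λ → S)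
    (m : ↥M → S) : ∑ ρ, (if res M ρ = m then rk U β θ Γ ζ ρ else 0) = qM U β θ Γ M ζ m := by
  have hγ := U.isSpecification_spec β
  set θ₁ := glueWith Λ ζ θ with hθ₁
  haveI := hγ.isProbability Γ θ₁
  unfold qM rk wt
  rw [real_eq_sum_fiber Γ (U.spec β Γ θ₁) (hγ.proper Γ θ₁) (measurableSet_cyl M m)]
  refine Finset.sum_congr rfl fun ρ _ => ?_
  have hiff : glueWith Γ ρ θ₁ ∈ cyl M m ↔ res M ρ = m := by
    rw [mem_cyl]
    constructor
    · intro h; funext x; rw [res_apply _ _ (hM x.2), ← h x, glueWith_apply_mem Γ ρ θ₁ (hM x.2)]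
    · intro h x; rw [glueWith_apply_mem Γ ρ θ₁ (hM x.2), ← res_apply (M := M) ρ x (hM x.2), h]
  by_cases h : res M ρ = m
  · rw [if_pos h, if_pos (hiff.2 h), mul_one]
  · rw [if_neg h, if_neg (fun h' => h (hiff.1 h')), mul_zero]

/-- The marginal weights sum to one (`M ⊆ Γ`). [cite: MartinelliOlivieriSchonmann1994, §2 (2.8)] -/
theorem sum_qM {Γ M : Finset (Site d)} (hM : M ⊆ Γ) (θ : Site d → S) (ζ : ↥Λ → S) :
    ∑ m, qM U β θ Γ M ζ m = 1 := by
  have h := sum_mul_res_eq (M := M) (fun _ => (1 : ℝ)) (rk U β θ Γ ζ)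
  simp only [one_mul] at h
  simp_rw [sum_rk_ite_eq_qM U β hM θ ζ] at h
  rw [← h, sum_rk]

/-- A single resampling weight is at most the marginal weight of its restriction (`M ⊆ Γ`).
[cite: MartinelliOlivieriSchonmann1994, §2 (2.8)] -/
theorem rk_le_qM {Γ M : Finset (Site d)} (hM : M ⊆ Γ) (θ : Site d → S) (ζ : ↥Λ → S) (ρ : ↥Γ → S) :
    rk U β θ Γ ζ ρ ≤ qM U β θ Γ M ζ (res M ρ) := by
  rw [← sum_rk_ite_eq_qM U β hM θ ζ (res M ρ)]
  have h0 : ∀ ρ' ∈ (Finset.univ : Finset (↥Γ → S)),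
      0 ≤ (if res M ρ' = res M ρ then rk U β θ Γ ζ ρ' else 0) := by
    intro ρ' _
    split_ifs
    · exact rk_nonneg U β θ Γ ζ ρ'
    · exact le_rfl
  have h := Finset.single_le_sum h0 (Finset.mem_univ ρ)
  rwa [if_pos rfl] at h

/-! #### The DLR equations in fibre-weight form -/

omit [DecidableEq S] in
/-- On the fibre of `ζ′` (configurations agreeing with `ζ′` off `Γ`) the resampling weight of the `Γ`-part of
`ζ′` does not depend on the input: it is `μ_Γ^{ξ′}(σ ≡ ξ′ on Γ)`, `ξ′ = glueWith Λ ζ′ θ` (Doob–Dynkin /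
finite-range Markov property of the kernel `μ_Γ`). [cite: MartinelliOlivieriSchonmann1994, §2 (2.5)] -/
theorem rk_res_eq_of_agr {Γ : Finset (Site d)} (hΓ : Γ ⊆ Λ) (θ : Site d → S) {ζ ζ' : ↥Λ → S}
    (hA : Agr (Λ \ Γ) ζ ζ') :
    rk U β θ Γ ζ (res Γ ζ') = (U.spec β Γ (glueWith Λ ζ' θ)).real (agreeOn Γ (glueWith Λ ζ' θ)) := by
  unfold rk wt
  have hset : fiber Γ (glueWith Λ ζ θ) (res Γ ζ') = agreeOn Γ (glueWith Λ ζ' θ) := by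
    unfold fiber
    refine agreeOn_congr' fun x hx => ?_
    rw [glueWith_apply_mem Γ _ _ hx, res_apply _ _ (hΓ hx), glueWith_apply_mem Λ ζ' θ (hΓ hx)]
  rw [hset]
  refine U.spec_real_eq_of_agree β Γ (measurableSet_agreeOn' Γ _) (T := (↑Γ : Set (Site d)))
    (dependsOn_agreeOn' Γ _) (fun x hx hx' => absurd (Finset.mem_coe.1 hx) hx') fun x hx => ?_
  have hxΓ : x ∉ Γ := (mem_rOuterBoundary.1 hx).1
  by_cases hxΛ : x ∈ Λ
  · rw [glueWith_apply_mem Λ ζ θ hxΛ, glueWith_apply_mem Λ ζ' θ hxΛ]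
    exact hA ⟨x, hxΛ⟩ (Finset.mem_sdiff.2 ⟨hxΛ, hxΓ⟩)
  · rw [glueWith_apply_not_mem Λ ζ θ hxΛ, glueWith_apply_not_mem Λ ζ' θ hxΛ]

/-- **The DLR equations in fibre-weight form** ([MOS94] (2.5), fourth equality): resampling `Γ ⊆ Λ` from its
conditional law under `μ_Λ^θ` leaves `μ_Λ^θ` invariant —
`Σ_ζ μ_Λ^θ(ζ) Σ_ρ μ_Γ^{(ζθ)}(ρ) g(ζ with Γ-part ρ) = Σ_ζ μ_Λ^θ(ζ) g(ζ)`.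
[cite: MartinelliOlivieriSchonmann1994, §2 (2.5)] -/
theorem sum_wt_rk {Γ : Finset (Site d)} (hΓ : Γ ⊆ Λ) (θ : Site d → S) (g : (↥Λ → S) → ℝ) :
    ∑ ζ, wt (U.spec β) Λ θ ζ * ∑ ρ, rk U β θ Γ ζ ρ * g (splice ζ ρ) =
      ∑ ζ, wt (U.spec β) Λ θ ζ * g ζ := by
  have hγ := U.isSpecification_spec β
  set w := wt (U.spec β) Λ θ with hw
  -- insert `1 = Σ_{ζ'} [splice ζ ρ = ζ']` and exchange the sums
  have h1 : ∑ ζ, w ζ * ∑ ρ, rk U β θ Γ ζ ρ * g (splice ζ ρ) =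
      ∑ ζ, ∑ ρ, (w ζ * rk U β θ Γ ζ ρ) * g (splice ζ ρ) := by
    refine Finset.sum_congr rfl fun ζ _ => ?_
    rw [Finset.mul_sum]
    refine Finset.sum_congr rfl fun ρ _ => ?_
    ring
  rw [h1, sum_sum_mul_eq_sum_fiber (fun ζ ρ => splice ζ ρ) (fun ζ ρ => w ζ * rk U β θ Γ ζ ρ) g]
  refine Finset.sum_congr rfl fun ζ' _ => ?_
  rw [mul_comm]
  -- the fibre of `ζ'`
  set ξ' := glueWith Λ ζ' θ with hξ'
  set c : ℝ := (U.spec β Γ ξ').real (agreeOn Γ ξ') with hc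
  have h2 : ∀ ζ, ∑ ρ, (if splice ζ ρ = ζ' then w ζ * rk U β θ Γ ζ ρ else 0) =
      if Agr (Λ \ Γ) ζ ζ' then w ζ * c else 0 := by
    intro ζ
    by_cases hA : Agr (Λ \ Γ) ζ ζ'
    · rw [if_pos hA, Finset.sum_eq_single (res Γ ζ')]
      · rw [if_pos ((splice_eq_iff hΓ ζ ζ' _).2 ⟨rfl, hA⟩), rk_res_eq_of_agr U β hΓ θ hA]
      · intro ρ _ hρ
        rw [if_neg]
        intro h
        exact hρ ((splice_eq_iff hΓ ζ ζ' ρ).1 h).1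
      · intro h; exact absurd (Finset.mem_univ _) h
    · rw [if_neg hA]
      refine Finset.sum_eq_zero fun ρ _ => if_neg fun h => hA ((splice_eq_iff hΓ ζ ζ' ρ).1 h).2
  simp_rw [h2]
  -- `Σ_{ζ ≡ ζ' off Γ} w ζ = μ_Λ^θ(σ ≡ ξ' on Λ ∖ Γ)`
  have h3 : ∑ ζ, (if Agr (Λ \ Γ) ζ ζ' then w ζ * c else 0) = Wt w (Λ \ Γ) ζ' * c := by
    unfold Wt
    rw [Finset.sum_mul]
    refine Finset.sum_congr rfl fun ζ _ => ?_
    split_ifs <;> simp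
  rw [h3, hw, Wt_wt_eq hγ Finset.sdiff_subset θ ζ']
  -- the factorisation `μ_Λ^θ(σ ≡ ξ' on Λ) = μ_Γ^{ξ'}(σ ≡ ξ' on Γ) μ_Λ^θ(σ ≡ ξ' on Λ ∖ Γ)`
  have h4 : wt (U.spec β) Λ θ ζ' = c * (U.spec β Λ θ).real (agreeOn (Λ \ Γ) ξ') := by
    unfold wt fiber
    rw [measureReal_def, weight_factor hγ hΓ (η := θ) (ξ := ξ') fun x hx => glueWith_apply_not_mem Λ ζ' θ hx,
      ENNReal.toReal_mul, hc, measureReal_def, measureReal_def]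
  rw [h4]
  ring

/-! #### The finite-range Markov property for the two copies -/

omit [DecidableEq S] in
/-- **The conditional laws on `Γ` of the two copies coincide** when the inputs agree on a set `D` containing
`∂_r^+Γ ∩ Λ` and the two outer boundary conditions agree on `∂_r^+Γ ∖ Λ` ([MOS94] (2.7): «keep in mind
that the range of interaction is `r`»). [cite: MartinelliOlivieriSchonmann1994, §2 (2.7)] -/
theorem rk_eq_of_agr {Γ D : Finset (Site d)} {τ τ' : Site d → S} {ζ₁ ζ₂ : ↥Λ → S}
    (hbd : ∀ x ∈ rOuterBoundary r Γ, x ∈ Λ → x ∈ D)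
    (hout : ∀ x ∈ rOuterBoundary r Γ, x ∉ Λ → τ x = τ' x) (hA : Agr D ζ₁ ζ₂) :
    rk U β τ Γ ζ₁ = rk U β τ' Γ ζ₂ := by
  funext ρ
  unfold rk wt
  have hset : fiber Γ (glueWith Λ ζ₁ τ) ρ = fiber Γ (glueWith Λ ζ₂ τ') ρ := by
    unfold fiber
    exact agreeOn_congr' fun x hx => by rw [glueWith_apply_mem Γ ρ _ hx, glueWith_apply_mem Γ ρ _ hx]
  rw [hset]
  refine U.spec_real_eq_of_agree β Γ (measurableSet_agreeOn' Γ _) (T := (↑Γ : Set (Site d)))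
    (dependsOn_agreeOn' Γ _) (fun x hx hx' => absurd (Finset.mem_coe.1 hx) hx') fun x hx => ?_
  by_cases hxΛ : x ∈ Λ
  · rw [glueWith_apply_mem Λ ζ₁ τ hxΛ, glueWith_apply_mem Λ ζ₂ τ' hxΛ]
    exact hA ⟨x, hxΛ⟩ (hbd x hx hxΛ)
  · rw [glueWith_apply_not_mem Λ ζ₁ τ hxΛ, glueWith_apply_not_mem Λ ζ₂ τ' hxΛ]
    exact hout x hx hxΛ

/-- Under the same hypotheses the `M`-marginals coincide (`M ⊆ Γ`). [cite: MartinelliOlivieriSchonmann1994, §2 (2.7)] -/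
theorem qM_eq_of_agr {Γ D M : Finset (Site d)} (hM : M ⊆ Γ) {τ τ' : Site d → S} {ζ₁ ζ₂ : ↥Λ → S}
    (hbd : ∀ x ∈ rOuterBoundary r Γ, x ∈ Λ → x ∈ D)
    (hout : ∀ x ∈ rOuterBoundary r Γ, x ∉ Λ → τ x = τ' x) (hA : Agr D ζ₁ ζ₂) :
    qM U β τ Γ M ζ₁ = qM U β τ' Γ M ζ₂ := by
  funext m
  rw [← sum_rk_ite_eq_qM U β hM, ← sum_rk_ite_eq_qM U β hM, rk_eq_of_agr U β hbd hout hA]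

/-! #### Finite energy: patterns on a small set keep a fixed fraction of the mass -/

omit [DecidableEq S] in
/-- **Finite-energy lower bound** for the marginal on `M = B ∪ A` in terms of the marginal on `B`:
`μ_Γ^θ(σ_M = m) ≥ ε(|A|) μ_Γ^θ(σ_B = m_B)` (DLR at `A = M ∖ B ⊆ Γ` and the atom bound for `μ_A`).
[cite: MartinelliOlivieriSchonmann1994, §2 (2.10)] -/
theorem spec_real_cyl_ge_mul {Γ M B : Finset (Site d)} (hMΓ : M ⊆ Γ) {C : ℝ} (hC0 : 0 ≤ C)
    (hC : ∀ (X : Finset (Site d)) (σ : Site d → S), |U.U X σ| ≤ C) {a : ℕ} (ha : (M \ B).card ≤ a)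
    (θ : Site d → S) (m : ↥M → S) :
    atomLB β C r d (Fintype.card S) a * (U.spec β Γ θ).real (cyl B (res B m)) ≤
      (U.spec β Γ θ).real (cyl M m) := by
  have hγ := U.isSpecification_spec β
  haveI := hγ.isProbability Γ θ
  set A := M \ B with hAdef
  have hAΓ : A ⊆ Γ := Finset.sdiff_subset.trans hMΓ
  set ε := atomLB β C r d (Fintype.card S) a with hε
  have hε0 : 0 ≤ ε := (atomLB_pos β C r d Fintype.card_pos a).le
  -- pointwise: `ε 1_{σ_B = m_B} ≤ μ_A^σ(σ'_M = m)`
  have hpt : ∀ σ, (cyl B (res B m)).indicator (fun _ => ENNReal.ofReal ε) σ ≤ U.spec β A σ (cyl M m) := by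
    intro σ
    by_cases hσ : σ ∈ cyl B (res B m)
    · rw [Set.indicator_of_mem hσ]
      haveI := hγ.isProbability A σ
      set κ : ↥A → S := fun x => m ⟨x, (Finset.mem_sdiff.1 x.2).1⟩ with hκ
      have hmem : glueWith A κ σ ∈ cyl M m := by
        intro x
        by_cases hxA : (x : Site d) ∈ A
        · rw [glueWith_apply_mem A κ σ hxA]
        · have hxB : (x : Site d) ∈ B := by
            by_contra hxB; exact hxA (Finset.mem_sdiff.2 ⟨x.2, hxB⟩)
          rw [glueWith_apply_not_mem A κ σ hxA, hσ ⟨x, hxB⟩]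
          exact res_apply m ⟨(x : Site d), hxB⟩ x.2
      have h1 : ε ≤ (U.spec β A σ).real (cyl M m) :=
        (spec_real_glue_ge U β hC0 hC ha σ κ).trans (measureReal_mono (Set.singleton_subset_iff.2 hmem))
      exact (ENNReal.ofReal_le_ofReal h1).trans_eq (ENNReal.ofReal_toReal (measure_ne_top _ _))
    · rw [Set.indicator_of_notMem hσ]; exact bot_le
  have hint : ENNReal.ofReal ε * U.spec β Γ θ (cyl B (res B m)) ≤ U.spec β Γ θ (cyl M m) := by
    rw [← hγ.consistent hAΓ θ _ (measurableSet_cyl M m),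
      ← lintegral_indicator_const (measurableSet_cyl B (res B m))]
    exact lintegral_mono hpt
  have h := ENNReal.toReal_mono (measure_ne_top _ _) hint
  rwa [ENNReal.toReal_mul, ENNReal.toReal_ofReal hε0] at h

/-! #### Total variation of the marginals -/

/-- The `B`-cylinder set of a finite family of patterns. [folklore] -/
def cylSet (B : Finset (Site d)) (F : Finset (↥B → S)) : Set (Site d → S) := {σ | (fun x : ↥B => σ x) ∈ F}

omit [Fintype S] [Nonempty S] [DecidableEq S] in
/-- Cylinder sets are measurable. [folklore] -/
private theorem measurableSet_cylSet (B : Finset (Site d)) (F : Finset (↥B → S)) : MeasurableSet (cylSet B F) := by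
  have : cylSet B F = ⋃ b ∈ F, cyl B b := by
    ext σ
    simp only [cylSet, Set.mem_setOf_eq, Set.mem_iUnion, mem_cyl, exists_prop]
    constructor
    · intro h; exact ⟨_, h, fun x => rfl⟩
    · rintro ⟨b, hb, h⟩
      have : (fun x : ↥B => σ x) = b := funext h
      rwa [this]
  rw [this]
  exact MeasurableSet.biUnion F.countable_toSet fun b _ => measurableSet_cyl B b

omit [MeasurableSpace S] [MeasurableSingletonClass S] [Fintype S] [Nonempty S] [DecidableEq S] in
/-- Cylinder sets are local. [folklore] -/
private theorem dependsOn_cylSet (B : Finset (Site d)) (F : Finset (↥B → S)) :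
    DependsOn (· ∈ cylSet B F) (↑B : Set (Site d)) := by
  intro σ σ' h
  have : (fun x : ↥B => σ x) = fun x : ↥B => σ' x := funext fun x => h x.1 (Finset.mem_coe.2 x.2)
  simp only [cylSet, Set.mem_setOf_eq, this]

/-- The mass of a cylinder set is the sum of the marginal weights (`B ⊆ Γ`). [folklore] -/
private theorem spec_real_cylSet {Γ B : Finset (Site d)} (hB : B ⊆ Γ) (θ : Site d → S) (ζ : ↥Λ → S)
    (F : Finset (↥B → S)) :
    (U.spec β Γ (glueWith Λ ζ θ)).real (cylSet B F) = ∑ b ∈ F, qM U β θ Γ B ζ b := by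
  have hγ := U.isSpecification_spec β
  set θ₁ := glueWith Λ ζ θ
  haveI := hγ.isProbability Γ θ₁
  rw [real_eq_sum_fiber Γ (U.spec β Γ θ₁) (hγ.proper Γ θ₁) (measurableSet_cylSet B F)]
  have hq : ∀ b, qM U β θ Γ B ζ b = ∑ ρ, (if res B ρ = b then rk U β θ Γ ζ ρ else 0) :=
    fun b => (sum_rk_ite_eq_qM U β hB θ ζ b).symm
  simp_rw [hq]
  rw [Finset.sum_comm]
  refine Finset.sum_congr rfl fun ρ _ => ?_
  have hres : (fun x : ↥B => glueWith Γ ρ θ₁ x) = res B ρ := by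
    funext x; rw [glueWith_apply_mem Γ ρ θ₁ (hB x.2), res_apply _ _ (hB x.2)]
  have hmem : glueWith Γ ρ θ₁ ∈ cylSet B F ↔ res B ρ ∈ F := by
    simp only [cylSet, Set.mem_setOf_eq, hres]
  unfold rk wt
  by_cases h : res B ρ ∈ F
  · rw [if_pos (hmem.2 h), mul_one, Finset.sum_eq_single_of_mem (res B ρ) h]
    · rw [if_pos rfl]
    · intro b _ hb; rw [if_neg (Ne.symm hb)]
  · rw [if_neg (fun h' => h (hmem.1 h')), mul_zero]
    symm
    refine Finset.sum_eq_zero fun b hb => ?_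
    have hne : res B ρ ≠ b := fun h' => h (h'.symm ▸ hb)
    rw [if_neg hne]

/-- **Total variation of the `B`-marginals as a difference of probabilities of ONE `B`-local event**
(`tvd q q′ = q(F) − q′(F)`, `F = {q′ < q}`). [cite: MartinelliOlivieriSchonmann1994, §2 (2.8)] -/
theorem tvd_qM_eq {Γ B : Finset (Site d)} (hB : B ⊆ Γ) (τ τ' : Site d → S) (ζ₁ ζ₂ : ↥Λ → S) :
    ∃ E : Set (Site d → S), MeasurableSet E ∧ DependsOn (· ∈ E) (↑B : Set (Site d)) ∧
      tvd (qM U β τ Γ B ζ₁) (qM U β τ' Γ B ζ₂) =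
        (U.spec β Γ (glueWith Λ ζ₁ τ)).real E - (U.spec β Γ (glueWith Λ ζ₂ τ')).real E := by
  set F := Finset.univ.filter fun b : ↥B → S => qM U β τ' Γ B ζ₂ b < qM U β τ Γ B ζ₁ b
  refine ⟨cylSet B F, measurableSet_cylSet B F, dependsOn_cylSet B F, ?_⟩
  rw [tvd_eq_sum_filter, spec_real_cylSet U β hB, spec_real_cylSet U β hB, ← Finset.sum_sub_distrib]

omit [DecidableEq S] in
/-- `Σ_m min(q₁ m, q₂ m) = 1 − tvd q₁ q₂` for the marginals (`M ⊆ Γ`). [folklore] -/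
private theorem sum_min_qM_eq {Γ M : Finset (Site d)} (hM : M ⊆ Γ) (τ τ' : Site d → S) (ζ₁ ζ₂ : ↥Λ → S) :
    ∑ m, min (qM U β τ Γ M ζ₁ m) (qM U β τ' Γ M ζ₂ m) = 1 - tvd (qM U β τ Γ M ζ₁) (qM U β τ' Γ M ζ₂) := by
  unfold tvd
  rw [Finset.sum_sub_distrib, sum_qM U β hM]
  ring

omit [DecidableEq S] in
/-- **The agreement mass of step (B)** ([MOS94] (2.8)–(2.10)): for `B ⊆ M ⊆ Γ` with `|M ∖ B| ≤ a`,
`Σ_m min(q₁ m, q₂ m) ≥ ε(a) · (1 − ‖q₁^B − q₂^B‖)`. [cite: MartinelliOlivieriSchonmann1994, §2 (2.10)] -/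
theorem sum_min_qM_ge {Γ M B : Finset (Site d)} (hBM : B ⊆ M) (hMΓ : M ⊆ Γ) {C : ℝ} (hC0 : 0 ≤ C)
    (hC : ∀ (X : Finset (Site d)) (σ : Site d → S), |U.U X σ| ≤ C) {a : ℕ} (ha : (M \ B).card ≤ a)
    (τ τ' : Site d → S) (ζ₁ ζ₂ : ↥Λ → S) :
    atomLB β C r d (Fintype.card S) a * (1 - tvd (qM U β τ Γ B ζ₁) (qM U β τ' Γ B ζ₂)) ≤
      ∑ m, min (qM U β τ Γ M ζ₁ m) (qM U β τ' Γ M ζ₂ m) := by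
  set ε := atomLB β C r d (Fintype.card S) a with hε
  have hε0 : 0 ≤ ε := (atomLB_pos β C r d Fintype.card_pos a).le
  rw [← sum_min_qM_eq U β (hBM.trans hMΓ)]
  -- pointwise finite-energy bound, summed over the extensions of the `B`-patterns
  have hpt : ∀ m, ε * min (qM U β τ Γ B ζ₁ (res B m)) (qM U β τ' Γ B ζ₂ (res B m)) ≤
      min (qM U β τ Γ M ζ₁ m) (qM U β τ' Γ M ζ₂ m) := by
    intro m
    rw [mul_min_of_nonneg _ _ hε0]
    exact min_le_min (spec_real_cyl_ge_mul U β hMΓ hC0 hC ha _ m)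
      (spec_real_cyl_ge_mul U β hMΓ hC0 hC ha _ m)
  calc ε * ∑ b, min (qM U β τ Γ B ζ₁ b) (qM U β τ' Γ B ζ₂ b)
      = ∑ b : ↥B → S, ε * min (qM U β τ Γ B ζ₁ (res B (res M b))) (qM U β τ' Γ B ζ₂ (res B (res M b))) := by
        rw [Finset.mul_sum]
        simp_rw [res_res_of_subset hBM]
    _ ≤ ∑ m, ε * min (qM U β τ Γ B ζ₁ (res B m)) (qM U β τ' Γ B ζ₂ (res B m)) :=
        sum_ge_sum_res hBM (f := fun m => ε * min (qM U β τ Γ B ζ₁ (res B m)) (qM U β τ' Γ B ζ₂ (res B m)))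
          fun m => mul_nonneg hε0 (le_min (qM_nonneg U β _ _ _ _ _) (qM_nonneg U β _ _ _ _ _))
    _ ≤ _ := Finset.sum_le_sum fun m _ => hpt m

end Kernels

/-! ### The surgery step: optimal coupling of the marginals, independent completion -/

section Surgery

variable (U : FRPotential d S r) (β : ℝ) {Λ : Finset (Site d)} (τ τ' : Site d → S)

omit [MeasurableSpace S] [MeasurableSingletonClass S] [Fintype S] [DecidableEq S] in
/-- The restriction of a `Γ`-configuration to `Γ` itself is the configuration. [folklore] -/
private theorem res_self {Γ : Finset (Site d)} (ρ : ↥Γ → S) : res Γ ρ = ρ := by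
  funext x; exact res_apply ρ x x.2

omit [MeasurableSpace S] [MeasurableSingletonClass S] [Fintype S] [Nonempty S] [DecidableEq S] in
/-- `c / q · q = c` for `0 ≤ c ≤ q` (also when `q = 0`). [folklore] -/
private theorem div_mul_cancel_of_le {c q : ℝ} (hc : 0 ≤ c) (hcq : c ≤ q) : c / q * q = c := by
  by_cases hq : q = 0
  · have : c = 0 := le_antisymm (hq ▸ hcq) hc
    rw [this, zero_div, zero_mul]
  · exact div_mul_cancel₀ c hq

omit [MeasurableSpace S] [MeasurableSingletonClass S] [Fintype S] [Nonempty S] in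
/-- The optimal coupling of a vector with itself is diagonal. [cite: GeorgiiHaggstromMaes2001, Theorem 7.1 (proof: optimal coupling)] -/
theorem copt_self_of_ne {X : Type*} [Fintype X] [DecidableEq X] (q : X → ℝ) {m₁ m₂ : X} (h : m₁ ≠ m₂) :
    copt q q m₁ m₂ = 0 := by
  unfold copt tvd
  simp [h]

/-- Averaging `g(res ρ)/q(res ρ)` against the resampling kernel gives `Σ_m g m` when `0 ≤ g ≤ q`
(`M ⊆ Γ`). [folklore] -/
private theorem sum_div_mul_rk {Γ M : Finset (Site d)} (hM : M ⊆ Γ) (θ : Site d → S) (ζ : ↥Λ → S)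
    (g : (↥M → S) → ℝ) (hg0 : ∀ m, 0 ≤ g m) (hgq : ∀ m, g m ≤ qM U β θ Γ M ζ m) :
    ∑ ρ, g (res M ρ) / qM U β θ Γ M ζ (res M ρ) * rk U β θ Γ ζ ρ = ∑ m, g m := by
  rw [sum_mul_res_eq (fun m => g m / qM U β θ Γ M ζ m) (rk U β θ Γ ζ)]
  refine Finset.sum_congr rfl fun m _ => ?_
  rw [sum_rk_ite_eq_qM U β hM, div_mul_cancel_of_le (hg0 m) (hgq m)]

/-- **The step kernel** `T_p(ρ₁, ρ₂)` of the surgery on `Γ` with mark set `M`: the optimal coupling of the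
two `M`-marginals, completed independently given the `M`-parts ([MOS94] (2.7)–(2.9) in one formula).
[cite: MartinelliOlivieriSchonmann1994, §2 (2.7)–(2.9)] -/
def T (Γ M : Finset (Site d)) (p : (↥Λ → S) × (↥Λ → S)) (ρ₁ ρ₂ : ↥Γ → S) : ℝ :=
  copt (qM U β τ Γ M p.1) (qM U β τ' Γ M p.2) (res M ρ₁) (res M ρ₂) *
    (rk U β τ Γ p.1 ρ₁ / qM U β τ Γ M p.1 (res M ρ₁)) * (rk U β τ' Γ p.2 ρ₂ / qM U β τ' Γ M p.2 (res M ρ₂))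

omit [MeasurableSingletonClass S] in
/-- The step kernel is non-negative. [cite: MartinelliOlivieriSchonmann1994, §2 (2.4)] -/
theorem T_nonneg (Γ M : Finset (Site d)) (p : (↥Λ → S) × (↥Λ → S)) (ρ₁ ρ₂ : ↥Γ → S) :
    0 ≤ T U β τ τ' Γ M p ρ₁ ρ₂ :=
  mul_nonneg (mul_nonneg (copt_nonneg (qM_nonneg U β _ _ _ _) (qM_nonneg U β _ _ _ _) _ _)
    (div_nonneg (rk_nonneg U β _ _ _ _) (qM_nonneg U β _ _ _ _ _)))
    (div_nonneg (rk_nonneg U β _ _ _ _) (qM_nonneg U β _ _ _ _ _))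

/-- First marginal of the step kernel: the resampling kernel of copy 1 ([MOS94] (iii) of a surgery).
[cite: MartinelliOlivieriSchonmann1994, §2 (iii)] -/
theorem sum_T_snd {Γ M : Finset (Site d)} (hM : M ⊆ Γ) (p : (↥Λ → S) × (↥Λ → S)) (ρ₁ : ↥Γ → S) :
    ∑ ρ₂, T U β τ τ' Γ M p ρ₁ ρ₂ = rk U β τ Γ p.1 ρ₁ := by
  set q₁ := qM U β τ Γ M p.1
  set q₂ := qM U β τ' Γ M p.2
  have hsum : ∑ m, q₁ m = ∑ m, q₂ m := by rw [sum_qM U β hM, sum_qM U β hM]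
  have h1 : ∀ ρ₂, T U β τ τ' Γ M p ρ₁ ρ₂ = (rk U β τ Γ p.1 ρ₁ / q₁ (res M ρ₁)) *
      (copt q₁ q₂ (res M ρ₁) (res M ρ₂) / q₂ (res M ρ₂) * rk U β τ' Γ p.2 ρ₂) := by
    intro ρ₂; unfold T; ring
  simp_rw [h1]
  rw [← Finset.mul_sum, sum_div_mul_rk U β hM τ' p.2 (fun m => copt q₁ q₂ (res M ρ₁) m)
    (fun m => copt_nonneg (qM_nonneg U β _ _ _ _) (qM_nonneg U β _ _ _ _) _ _)
    (fun m => copt_le_snd hsum (qM_nonneg U β _ _ _ _) (qM_nonneg U β _ _ _ _) _ _),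
    sum_copt_snd hsum]
  exact div_mul_cancel_of_le (rk_nonneg U β _ _ _ _) (rk_le_qM U β hM τ p.1 ρ₁)

/-- Second marginal of the step kernel: the resampling kernel of copy 2.
[cite: MartinelliOlivieriSchonmann1994, §2 (iii)] -/
theorem sum_T_fst {Γ M : Finset (Site d)} (hM : M ⊆ Γ) (p : (↥Λ → S) × (↥Λ → S)) (ρ₂ : ↥Γ → S) :
    ∑ ρ₁, T U β τ τ' Γ M p ρ₁ ρ₂ = rk U β τ' Γ p.2 ρ₂ := by
  set q₁ := qM U β τ Γ M p.1
  set q₂ := qM U β τ' Γ M p.2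
  have hsum : ∑ m, q₁ m = ∑ m, q₂ m := by rw [sum_qM U β hM, sum_qM U β hM]
  have h1 : ∀ ρ₁, T U β τ τ' Γ M p ρ₁ ρ₂ = (rk U β τ' Γ p.2 ρ₂ / q₂ (res M ρ₂)) *
      (copt q₁ q₂ (res M ρ₁) (res M ρ₂) / q₁ (res M ρ₁) * rk U β τ Γ p.1 ρ₁) := by
    intro ρ₁; unfold T; ring
  simp_rw [h1]
  rw [← Finset.mul_sum, sum_div_mul_rk U β hM τ p.1 (fun m => copt q₁ q₂ m (res M ρ₂))
    (fun m => copt_nonneg (qM_nonneg U β _ _ _ _) (qM_nonneg U β _ _ _ _) _ _)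
    (fun m => copt_le_fst hsum (qM_nonneg U β _ _ _ _) (qM_nonneg U β _ _ _ _) _ _),
    sum_copt_fst hsum]
  exact div_mul_cancel_of_le (rk_nonneg U β _ _ _ _) (rk_le_qM U β hM τ' p.2 ρ₂)

/-- The total mass of the step kernel is one. [cite: MartinelliOlivieriSchonmann1994, §2 (2.4)] -/
theorem sum_sum_T {Γ M : Finset (Site d)} (hM : M ⊆ Γ) (p : (↥Λ → S) × (↥Λ → S)) :
    ∑ ρ₁, ∑ ρ₂, T U β τ τ' Γ M p ρ₁ ρ₂ = 1 := by
  simp_rw [sum_T_snd U β τ τ' hM]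
  exact sum_rk U β τ Γ p.1

/-- **The disagreement mass of the step kernel is at most the total variation of the marginals**
(`Σ_{ρ₁|_M ≠ ρ₂|_M} T_p(ρ₁,ρ₂) ≤ ‖q₁ − q₂‖`; [MOS94] (2.8) and «the remark concerning (1.8)»).
[cite: MartinelliOlivieriSchonmann1994, §2 (2.8)] -/
theorem sum_T_offDiag_le {Γ M : Finset (Site d)} (hM : M ⊆ Γ) (p : (↥Λ → S) × (↥Λ → S)) :
    ∑ ρ₁, ∑ ρ₂, (if res M ρ₁ = res M ρ₂ then 0 else T U β τ τ' Γ M p ρ₁ ρ₂) ≤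
      tvd (qM U β τ Γ M p.1) (qM U β τ' Γ M p.2) := by
  set q₁ := qM U β τ Γ M p.1
  set q₂ := qM U β τ' Γ M p.2
  have hsum : ∑ m, q₁ m = ∑ m, q₂ m := by rw [sum_qM U β hM, sum_qM U β hM]
  have hq₁ : ∀ m, 0 ≤ q₁ m := qM_nonneg U β _ _ _ _
  have hq₂ : ∀ m, 0 ≤ q₂ m := qM_nonneg U β _ _ _ _
  -- the off-diagonal part of the optimal coupling
  set D : (↥M → S) → (↥M → S) → ℝ := fun m₁ m₂ => if m₁ = m₂ then 0 else copt q₁ q₂ m₁ m₂ with hD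
  have hD0 : ∀ m₁ m₂, 0 ≤ D m₁ m₂ := fun m₁ m₂ => by
    simp only [hD]; split_ifs; exacts [le_rfl, copt_nonneg hq₁ hq₂ _ _]
  have hDle : ∀ m₁ m₂, D m₁ m₂ ≤ copt q₁ q₂ m₁ m₂ := fun m₁ m₂ => by
    simp only [hD]; split_ifs; exacts [copt_nonneg hq₁ hq₂ _ _, le_rfl]
  set G : (↥M → S) → ℝ := fun m₁ => ∑ m₂, D m₁ m₂ with hG
  have hG0 : ∀ m₁, 0 ≤ G m₁ := fun m₁ => Finset.sum_nonneg fun m₂ _ => hD0 m₁ m₂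
  have hGle : ∀ m₁, G m₁ ≤ q₁ m₁ := fun m₁ => by
    rw [← sum_copt_snd hsum m₁]; exact Finset.sum_le_sum fun m₂ _ => hDle m₁ m₂
  -- rewrite the summand
  have h1 : ∀ ρ₁ ρ₂, (if res M ρ₁ = res M ρ₂ then 0 else T U β τ τ' Γ M p ρ₁ ρ₂) =
      (rk U β τ Γ p.1 ρ₁ / q₁ (res M ρ₁)) *
        (D (res M ρ₁) (res M ρ₂) / q₂ (res M ρ₂) * rk U β τ' Γ p.2 ρ₂) := by
    intro ρ₁ ρ₂
    simp only [hD]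
    split_ifs
    · simp
    · unfold T; ring
  simp_rw [h1]
  have h2 : ∀ ρ₁, ∑ ρ₂, (rk U β τ Γ p.1 ρ₁ / q₁ (res M ρ₁)) *
      (D (res M ρ₁) (res M ρ₂) / q₂ (res M ρ₂) * rk U β τ' Γ p.2 ρ₂) =
      G (res M ρ₁) / q₁ (res M ρ₁) * rk U β τ Γ p.1 ρ₁ := by
    intro ρ₁
    rw [← Finset.mul_sum, sum_div_mul_rk U β hM τ' p.2 (fun m => D (res M ρ₁) m) (fun m => hD0 _ _)
      (fun m => (hDle _ _).trans (copt_le_snd hsum hq₁ hq₂ _ _))]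
    ring
  simp_rw [h2]
  rw [sum_div_mul_rk U β hM τ p.1 G hG0 hGle]
  exact sum_copt_offDiag_le hsum

omit [MeasurableSingletonClass S] in
/-- In case (G) (equal marginals, mark set `Γ`) the step kernel is diagonal.
[cite: MartinelliOlivieriSchonmann1994, §2 (2.7)] -/
theorem T_eq_zero_of_eq {Γ : Finset (Site d)} (p : (↥Λ → S) × (↥Λ → S))
    (hq : qM U β τ Γ Γ p.1 = qM U β τ' Γ Γ p.2) {ρ₁ ρ₂ : ↥Γ → S} (hne : ρ₁ ≠ ρ₂) :
    T U β τ τ' Γ Γ p ρ₁ ρ₂ = 0 := by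
  unfold T
  rw [hq, copt_self_of_ne]
  · simp
  · rwa [res_self, res_self]

/-! ### The surgery step on couplings and its iteration -/

/-- Agreement of a pair of `Λ`-configurations on the set `D`. [cite: MartinelliOlivieriSchonmann1994, §2 (2.3)] -/
def AgrP (D : Finset (Site d)) (p : (↥Λ → S) × (↥Λ → S)) : Prop := Agr D p.1 p.2

/-- **One surgery step** on a pair function `ν`: resample `Γ` in both copies with the step kernel whose mark
set is `Γ` for pairs agreeing on `Dc` (case (G), [MOS94] (II.i)) and `Dn` otherwise (case (B), (II.ii)).
[cite: MartinelliOlivieriSchonmann1994, §2 (2.11)] -/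
def step (Γ Dc Dn : Finset (Site d)) (ν : (↥Λ → S) × (↥Λ → S) → ℝ) : (↥Λ → S) × (↥Λ → S) → ℝ :=
  fun p' => ∑ p, ν p * ∑ ρ : (↥Γ → S) × (↥Γ → S),
    T U β τ τ' Γ (if AgrP Dc p then Γ else Dn) p ρ.1 ρ.2 *
      (if (splice p.1 ρ.1, splice p.2 ρ.2) = p' then 1 else 0)

omit [MeasurableSpace S] [MeasurableSingletonClass S] [Fintype S] [Nonempty S] [DecidableEq S] in
/-- Push-forward form of a kernel step: `Σ_{p'} (Σ_p ν_p Σ_x K_p(x) [G_p(x) = p']) f(p') = Σ_p ν_p Σ_x K_p(x) f(G_p x)`.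
[folklore] -/
private theorem sum_push {Ω X : Type*} [Fintype Ω] [Fintype X] [DecidableEq Ω] (ν : Ω → ℝ) (K : Ω → X → ℝ)
    (G : Ω → X → Ω) (f : Ω → ℝ) :
    ∑ p', (∑ p, ν p * ∑ x, K p x * (if G p x = p' then 1 else 0)) * f p' =
      ∑ p, ν p * ∑ x, K p x * f (G p x) := by
  have h1 : ∀ p x, (∑ p', (if G p x = p' then (1 : ℝ) else 0) * f p') = f (G p x) := by
    intro p x
    rw [Finset.sum_eq_single (G p x)]
    · simp
    · intro p' _ hp'; rw [if_neg (Ne.symm hp'), zero_mul]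
    · intro h; exact absurd (Finset.mem_univ _) h
  calc ∑ p', (∑ p, ν p * ∑ x, K p x * (if G p x = p' then 1 else 0)) * f p'
      = ∑ p', ∑ p, ∑ x, ν p * (K p x * ((if G p x = p' then 1 else 0) * f p')) := by
        refine Finset.sum_congr rfl fun p' _ => ?_
        rw [Finset.sum_mul]
        refine Finset.sum_congr rfl fun p _ => ?_
        rw [mul_assoc, Finset.sum_mul, Finset.mul_sum]
        refine Finset.sum_congr rfl fun x _ => ?_
        ring
    _ = ∑ p, ∑ p', ∑ x, ν p * (K p x * ((if G p x = p' then 1 else 0) * f p')) := Finset.sum_comm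
    _ = ∑ p, ∑ x, ∑ p', ν p * (K p x * ((if G p x = p' then 1 else 0) * f p')) :=
        Finset.sum_congr rfl fun p _ => Finset.sum_comm
    _ = ∑ p, ν p * ∑ x, K p x * f (G p x) := by
        refine Finset.sum_congr rfl fun p _ => ?_
        rw [Finset.mul_sum]
        refine Finset.sum_congr rfl fun x _ => ?_
        rw [← Finset.mul_sum, ← Finset.mul_sum, h1]

omit [MeasurableSingletonClass S] in
/-- Expectations under the surgery step. [cite: MartinelliOlivieriSchonmann1994, §2 (2.4)] -/
theorem sum_step_mul (Γ Dc Dn : Finset (Site d)) (ν : (↥Λ → S) × (↥Λ → S) → ℝ)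
    (f : (↥Λ → S) × (↥Λ → S) → ℝ) :
    ∑ p', step U β τ τ' Γ Dc Dn ν p' * f p' =
      ∑ p, ν p * ∑ ρ : (↥Γ → S) × (↥Γ → S),
        T U β τ τ' Γ (if AgrP Dc p then Γ else Dn) p ρ.1 ρ.2 * f (splice p.1 ρ.1, splice p.2 ρ.2) :=
  sum_push ν (fun p (ρ : (↥Γ → S) × (↥Γ → S)) => T U β τ τ' Γ (if AgrP Dc p then Γ else Dn) p ρ.1 ρ.2)
    (fun p ρ => (splice p.1 ρ.1, splice p.2 ρ.2)) f

omit [MeasurableSingletonClass S] in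
/-- The surgery step preserves non-negativity. [cite: MartinelliOlivieriSchonmann1994, §2 (2.4)] -/
theorem step_nonneg (Γ Dc Dn : Finset (Site d)) {ν : (↥Λ → S) × (↥Λ → S) → ℝ} (hν : ∀ p, 0 ≤ ν p)
    (p' : (↥Λ → S) × (↥Λ → S)) : 0 ≤ step U β τ τ' Γ Dc Dn ν p' :=
  Finset.sum_nonneg fun p _ => mul_nonneg (hν p) (Finset.sum_nonneg fun ρ _ =>
    mul_nonneg (T_nonneg U β τ τ' _ _ _ _ _) (by split_ifs <;> norm_num))

/-- **The surgery step preserves the first marginal** ([MOS94] (2.5)). [cite: MartinelliOlivieriSchonmann1994, §2 (2.5)] -/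
theorem step_marg_fst {Γ Dc Dn : Finset (Site d)} (hΓ : Γ ⊆ Λ) (hDn : Dn ⊆ Γ)
    {ν : (↥Λ → S) × (↥Λ → S) → ℝ} (hν : ∀ g : (↥Λ → S) → ℝ, ∑ p, ν p * g p.1 = ∑ ζ, wt (U.spec β) Λ τ ζ * g ζ)
    (g : (↥Λ → S) → ℝ) : ∑ p', step U β τ τ' Γ Dc Dn ν p' * g p'.1 = ∑ ζ, wt (U.spec β) Λ τ ζ * g ζ := by
  rw [sum_step_mul]
  have h1 : ∀ p, ∑ ρ : (↥Γ → S) × (↥Γ → S), T U β τ τ' Γ (if AgrP Dc p then Γ else Dn) p ρ.1 ρ.2 *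
      g (splice p.1 ρ.1, splice p.2 ρ.2).1 = ∑ ρ₁, rk U β τ Γ p.1 ρ₁ * g (splice p.1 ρ₁) := by
    intro p
    have hM : (if AgrP Dc p then Γ else Dn) ⊆ Γ := by split_ifs; exacts [le_rfl, hDn]
    rw [Fintype.sum_prod_type]
    refine Finset.sum_congr rfl fun ρ₁ _ => ?_
    simp only
    rw [← Finset.sum_mul, sum_T_snd U β τ τ' hM]
  simp_rw [h1]
  rw [hν (fun ζ => ∑ ρ₁, rk U β τ Γ ζ ρ₁ * g (splice ζ ρ₁)), sum_wt_rk U β hΓ τ g]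

/-- **The surgery step preserves the second marginal** ([MOS94] (2.5)). [cite: MartinelliOlivieriSchonmann1994, §2 (2.5)] -/
theorem step_marg_snd {Γ Dc Dn : Finset (Site d)} (hΓ : Γ ⊆ Λ) (hDn : Dn ⊆ Γ)
    {ν : (↥Λ → S) × (↥Λ → S) → ℝ} (hν : ∀ g : (↥Λ → S) → ℝ, ∑ p, ν p * g p.2 = ∑ ζ, wt (U.spec β) Λ τ' ζ * g ζ)
    (g : (↥Λ → S) → ℝ) : ∑ p', step U β τ τ' Γ Dc Dn ν p' * g p'.2 = ∑ ζ, wt (U.spec β) Λ τ' ζ * g ζ := by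
  rw [sum_step_mul]
  have h1 : ∀ p, ∑ ρ : (↥Γ → S) × (↥Γ → S), T U β τ τ' Γ (if AgrP Dc p then Γ else Dn) p ρ.1 ρ.2 *
      g (splice p.1 ρ.1, splice p.2 ρ.2).2 = ∑ ρ₂, rk U β τ' Γ p.2 ρ₂ * g (splice p.2 ρ₂) := by
    intro p
    have hM : (if AgrP Dc p then Γ else Dn) ⊆ Γ := by split_ifs; exacts [le_rfl, hDn]
    rw [Fintype.sum_prod_type, Finset.sum_comm]
    refine Finset.sum_congr rfl fun ρ₂ _ => ?_
    simp only
    rw [← Finset.sum_mul, sum_T_fst U β τ τ' hM]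
  simp_rw [h1]
  rw [hν (fun ζ => ∑ ρ₂, rk U β τ' Γ ζ ρ₂ * g (splice ζ ρ₂)), sum_wt_rk U β hΓ τ' g]

omit [MeasurableSpace S] [MeasurableSingletonClass S] [Fintype S] [Nonempty S] [DecidableEq S] in
/-- Spliced pairs with the same `Γ`-part agree on every `X ⊆ Γ`. [folklore] -/
private theorem agrP_splice_of_subset {Γ X : Finset (Site d)} (hX : X ⊆ Γ) (p : (↥Λ → S) × (↥Λ → S))
    (ρ : ↥Γ → S) : AgrP X (splice p.1 ρ, splice p.2 ρ) := by
  intro x hx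
  show splice p.1 ρ x = splice p.2 ρ x
  rw [splice_apply_of_mem p.1 ρ (hX hx), splice_apply_of_mem p.2 ρ (hX hx)]

omit [MeasurableSpace S] [MeasurableSingletonClass S] [Fintype S] [DecidableEq S] in
/-- Spliced pairs agree on `M ⊆ Γ ⊆ Λ` iff the new `Γ`-parts agree on `M`. [folklore] -/
private theorem agrP_splice_iff {Γ M : Finset (Site d)} (hM : M ⊆ Γ) (hΓ : Γ ⊆ Λ) (p : (↥Λ → S) × (↥Λ → S))
    (ρ₁ ρ₂ : ↥Γ → S) : AgrP M (splice p.1 ρ₁, splice p.2 ρ₂) ↔ res M ρ₁ = res M ρ₂ := by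
  constructor
  · intro h; funext x
    have hxΓ : (x : Site d) ∈ Γ := hM x.2
    have h' : splice p.1 ρ₁ ⟨x, hΓ hxΓ⟩ = splice p.2 ρ₂ ⟨x, hΓ hxΓ⟩ := h ⟨x, hΓ hxΓ⟩ x.2
    rw [splice_apply_of_mem p.1 ρ₁ (x := ⟨x, hΓ hxΓ⟩) hxΓ,
      splice_apply_of_mem p.2 ρ₂ (x := ⟨x, hΓ hxΓ⟩) hxΓ] at h'
    rw [res_apply ρ₁ x hxΓ, res_apply ρ₂ x hxΓ]
    exact h'
  · intro h x hx
    show splice p.1 ρ₁ x = splice p.2 ρ₂ x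
    rw [splice_apply_of_mem p.1 ρ₁ (hM hx), splice_apply_of_mem p.2 ρ₂ (hM hx)]
    have := congrFun h ⟨x, hx⟩
    rwa [res_apply ρ₁ ⟨(x : Site d), hx⟩ (hM hx), res_apply ρ₂ ⟨(x : Site d), hx⟩ (hM hx)] at this

/-- **Contraction of the non-agreement mass in one step** ([MOS94] (2.10)–(2.12)).  Let `X ⊆ Γ`.  Pairs agreeing
on `Dc ⊇ ∂_r^+Γ ∩ Λ` produce outputs agreeing on `Γ ⊇ X` (case (G)); the others keep at most their mass,
and — when `X = Dn` and the agreement mass of the `Dn`-marginals is at least `δ` — at most `(1 − δ)` of it.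
[cite: MartinelliOlivieriSchonmann1994, §2 (2.10)–(2.12)] -/
theorem step_notAgr_le {Γ Dc Dn X : Finset (Site d)} (hΓ : Γ ⊆ Λ) (hDn : Dn ⊆ Γ) (hX : X ⊆ Γ)
    (hbd : ∀ x ∈ rOuterBoundary r Γ, x ∈ Λ → x ∈ Dc)
    (hout : ∀ x ∈ rOuterBoundary r Γ, x ∉ Λ → τ x = τ' x)
    {ν : (↥Λ → S) × (↥Λ → S) → ℝ} (hν : ∀ p, 0 ≤ ν p) {δ : ℝ} (hδ : 0 ≤ δ)
    (hgood : X = Dn ∧ (∀ p : (↥Λ → S) × (↥Λ → S), ¬ AgrP Dc p →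
      δ ≤ ∑ m, min (qM U β τ Γ Dn p.1 m) (qM U β τ' Γ Dn p.2 m)) ∨ δ = 0) :
    ∑ p', step U β τ τ' Γ Dc Dn ν p' * (if AgrP X p' then 0 else 1) ≤
      (1 - δ) * ∑ p, ν p * (if AgrP Dc p then 0 else 1) := by
  rw [sum_step_mul, Finset.mul_sum]
  refine Finset.sum_le_sum fun p _ => ?_
  by_cases hA : AgrP Dc p
  · -- case (G): the outputs agree on `Γ`
    rw [if_pos hA, if_pos hA, mul_zero, mul_zero]
    refine le_of_eq (mul_eq_zero_of_right _ (Finset.sum_eq_zero fun ρ _ => ?_))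
    by_cases hρ : ρ.1 = ρ.2
    · have : AgrP X (splice p.1 ρ.1, splice p.2 ρ.2) := by rw [hρ]; exact agrP_splice_of_subset hX p ρ.2
      rw [if_pos this, mul_zero]
    · rw [T_eq_zero_of_eq U β τ τ' p (qM_eq_of_agr U β le_rfl hbd hout hA) hρ, zero_mul]
  · -- case (B)
    rw [if_neg hA, if_neg hA, mul_one, mul_comm (1 - δ) (ν p)]
    refine mul_le_mul_of_nonneg_left ?_ (hν p)
    rcases hgood with ⟨rfl, hg⟩ | rfl
    · -- `X = Dn`: disagreement on `Dn` costs at most `tvd ≤ 1 − δ`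
      have h1 : ∑ ρ : (↥Γ → S) × (↥Γ → S), T U β τ τ' Γ X p ρ.1 ρ.2 *
          (if AgrP X (splice p.1 ρ.1, splice p.2 ρ.2) then 0 else 1) =
          ∑ ρ₁, ∑ ρ₂, (if res X ρ₁ = res X ρ₂ then 0 else T U β τ τ' Γ X p ρ₁ ρ₂) := by
        rw [Fintype.sum_prod_type]
        refine Finset.sum_congr rfl fun ρ₁ _ => Finset.sum_congr rfl fun ρ₂ _ => ?_
        simp only [agrP_splice_iff hDn hΓ]
        split_ifs <;> simp
      rw [h1]
      refine (sum_T_offDiag_le U β τ τ' hDn p).trans ?_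
      have := hg p hA
      rw [sum_min_qM_eq U β hDn] at this
      linarith
    · rw [sub_zero]
      calc ∑ ρ : (↥Γ → S) × (↥Γ → S), T U β τ τ' Γ Dn p ρ.1 ρ.2 *
            (if AgrP X (splice p.1 ρ.1, splice p.2 ρ.2) then 0 else 1)
          ≤ ∑ ρ : (↥Γ → S) × (↥Γ → S), T U β τ τ' Γ Dn p ρ.1 ρ.2 :=
            Finset.sum_le_sum fun ρ _ => by
              split_ifs
              · rw [mul_zero]; exact T_nonneg U β τ τ' _ _ _ _ _
              · rw [mul_one]
        _ = 1 := by rw [Fintype.sum_prod_type]; exact sum_sum_T U β τ τ' hDn p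

end Surgery

/-! ### Iterating the surgery along the scales -/

section Iteration

variable (U : FRPotential d S r) (β : ℝ) (Λ : Finset (Site d)) (τ τ' : Site d → S)

/-- **The coupling after `i` surgery steps** ([MOS94] (2.11)): start from the product coupling and apply the
surgeries on `Γ_1, Γ_2, …` with case sets `D_1, D_2, …` and mark sets `D_2, D_3, …`.
[cite: MartinelliOlivieriSchonmann1994, §2 (2.11)] -/
def coupling (Γs Ds : ℕ → Finset (Site d)) : ℕ → ((↥Λ → S) × (↥Λ → S) → ℝ)
  | 0 => fun p => wt (U.spec β) Λ τ p.1 * wt (U.spec β) Λ τ' p.2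
  | i + 1 => step U β τ τ' (Γs (i + 1)) (Ds (i + 1)) (Ds (i + 2)) (coupling Γs Ds i)

omit [MeasurableSingletonClass S] in
/-- The couplings are non-negative. [cite: MartinelliOlivieriSchonmann1994, §2 (2.11)] -/
theorem coupling_nonneg (Γs Ds : ℕ → Finset (Site d)) :
    ∀ (i : ℕ) (p : (↥Λ → S) × (↥Λ → S)), 0 ≤ coupling U β Λ τ τ' Γs Ds i p
  | 0, _ => mul_nonneg (wt_nonneg _ _ _ _) (wt_nonneg _ _ _ _)
  | i + 1, p => step_nonneg U β τ τ' _ _ _ (coupling_nonneg Γs Ds i) p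

/-- **The couplings have first marginal `μ_Λ^τ`** (fibre weights). [cite: MartinelliOlivieriSchonmann1994, §2 (2.5)] -/
theorem coupling_marg_fst (Γs Ds : ℕ → Finset (Site d)) {n : ℕ} (hΓ : ∀ i, 1 ≤ i → i ≤ n → Γs i ⊆ Λ)
    (hD : ∀ i, 1 ≤ i → i ≤ n → Ds (i + 1) ⊆ Γs i) :
    ∀ i, i ≤ n → ∀ g : (↥Λ → S) → ℝ,
      ∑ p, coupling U β Λ τ τ' Γs Ds i p * g p.1 = ∑ ζ, wt (U.spec β) Λ τ ζ * g ζ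
  | 0, _, g => by
    simp only [coupling]
    rw [Fintype.sum_prod_type]
    refine Finset.sum_congr rfl fun ζ _ => ?_
    simp only
    rw [← Finset.sum_mul, ← Finset.mul_sum, sum_wt (U.isSpecification_spec β) Λ τ', mul_one]
  | i + 1, hi, g => by
    simp only [coupling]
    exact step_marg_fst U β τ τ' (hΓ (i + 1) (by omega) hi) (hD (i + 1) (by omega) hi)
      (coupling_marg_fst Γs Ds hΓ hD i (by omega)) g

/-- **The couplings have second marginal `μ_Λ^{τ′}`**. [cite: MartinelliOlivieriSchonmann1994, §2 (2.5)] -/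
theorem coupling_marg_snd (Γs Ds : ℕ → Finset (Site d)) {n : ℕ} (hΓ : ∀ i, 1 ≤ i → i ≤ n → Γs i ⊆ Λ)
    (hD : ∀ i, 1 ≤ i → i ≤ n → Ds (i + 1) ⊆ Γs i) :
    ∀ i, i ≤ n → ∀ g : (↥Λ → S) → ℝ,
      ∑ p, coupling U β Λ τ τ' Γs Ds i p * g p.2 = ∑ ζ, wt (U.spec β) Λ τ' ζ * g ζ
  | 0, _, g => by
    simp only [coupling]
    rw [Fintype.sum_prod_type, Finset.sum_comm]
    refine Finset.sum_congr rfl fun ζ _ => ?_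
    simp only
    rw [← Finset.sum_mul, ← Finset.sum_mul, sum_wt (U.isSpecification_spec β) Λ τ, one_mul]
  | i + 1, hi, g => by
    simp only [coupling]
    exact step_marg_snd U β τ τ' (hΓ (i + 1) (by omega) hi) (hD (i + 1) (by omega) hi)
      (coupling_marg_snd Γs Ds hΓ hD i (by omega)) g

/-- The non-agreement mass of the coupling after `i` steps on the set `D`. [cite: MartinelliOlivieriSchonmann1994, §2 (2.12)] -/
def badMass (Γs Ds : ℕ → Finset (Site d)) (i : ℕ) (D : Finset (Site d)) : ℝ :=
  ∑ p : (↥Λ → S) × (↥Λ → S), coupling U β Λ τ τ' Γs Ds i p * (if AgrP D p then 0 else 1)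

/-- The initial non-agreement mass is at most one. [cite: MartinelliOlivieriSchonmann1994, §2 (2.12)] -/
theorem badMass_zero_le (Γs Ds : ℕ → Finset (Site d)) (D : Finset (Site d)) :
    badMass U β Λ τ τ' Γs Ds 0 D ≤ 1 := by
  unfold badMass
  calc ∑ p : (↥Λ → S) × (↥Λ → S), coupling U β Λ τ τ' Γs Ds 0 p * (if AgrP D p then 0 else 1)
      ≤ ∑ p : (↥Λ → S) × (↥Λ → S), coupling U β Λ τ τ' Γs Ds 0 p * 1 :=
        Finset.sum_le_sum fun p _ => mul_le_mul_of_nonneg_left (by split_ifs <;> norm_num)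
          (coupling_nonneg U β Λ τ τ' Γs Ds 0 p)
    _ = 1 := by
      have h := coupling_marg_fst U β Λ τ τ' Γs Ds (n := 0) (fun i h1 h2 => by omega)
        (fun i h1 h2 => by omega) 0 le_rfl (fun _ => 1)
      simp only [mul_one] at h ⊢
      rw [h, sum_wt (U.isSpecification_spec β) Λ τ]

/-- **The multiscale estimate** ([MOS94] (2.12)): after `i` steps the mass of pairs NOT agreeing on `D_{i+1}`
is at most `(1 − δ)^{#good steps ≤ i}`, where a step `j` is GOOD if every input pair not agreeing on `D_j`
yields `Σ_m min(q₁ m, q₂ m) ≥ δ` for the `D_{j+1}`-marginals on `Γ_j`.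
[cite: MartinelliOlivieriSchonmann1994, §2 (2.12)] -/
theorem badMass_le_pow (Γs Ds : ℕ → Finset (Site d)) {n : ℕ} (hΓ : ∀ i, 1 ≤ i → i ≤ n → Γs i ⊆ Λ)
    (hD : ∀ i, 1 ≤ i → i ≤ n → Ds (i + 1) ⊆ Γs i)
    (hbd : ∀ i, 1 ≤ i → i ≤ n → ∀ x ∈ rOuterBoundary r (Γs i), x ∈ Λ → x ∈ Ds i)
    (hout : ∀ i, 1 ≤ i → i ≤ n → ∀ x ∈ rOuterBoundary r (Γs i), x ∉ Λ → τ x = τ' x)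
    {δ : ℝ} (hδ0 : 0 ≤ δ) (hδ1 : δ ≤ 1) (good : ℕ → Prop)
    (hgood : ∀ i, 1 ≤ i → i ≤ n → good i → ∀ p : (↥Λ → S) × (↥Λ → S), ¬ AgrP (Ds i) p →
      δ ≤ ∑ m, min (qM U β τ (Γs i) (Ds (i + 1)) p.1 m) (qM U β τ' (Γs i) (Ds (i + 1)) p.2 m)) :
    ∀ i, i ≤ n → badMass U β Λ τ τ' Γs Ds i (Ds (i + 1)) ≤
      (1 - δ) ^ ((Finset.Icc 1 i).filter good).card
  | 0, _ => by
    rw [show Finset.Icc 1 0 = ∅ by rfl, Finset.filter_empty, Finset.card_empty, pow_zero]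
    exact badMass_zero_le U β Λ τ τ' Γs Ds _
  | i + 1, hi => by
    have IH := badMass_le_pow Γs Ds hΓ hD hbd hout hδ0 hδ1 good hgood i (by omega)
    have h1δ : 0 ≤ 1 - δ := sub_nonneg.2 hδ1
    -- the step `i+1`
    have hstep : ∀ δ', 0 ≤ δ' → ((Ds (i + 2) = Ds (i + 2) ∧ (∀ p : (↥Λ → S) × (↥Λ → S), ¬ AgrP (Ds (i + 1)) p →
        δ' ≤ ∑ m, min (qM U β τ (Γs (i + 1)) (Ds (i + 2)) p.1 m)
          (qM U β τ' (Γs (i + 1)) (Ds (i + 2)) p.2 m))) ∨ δ' = 0) →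
        badMass U β Λ τ τ' Γs Ds (i + 1) (Ds (i + 2)) ≤ (1 - δ') * badMass U β Λ τ τ' Γs Ds i (Ds (i + 1)) := by
      intro δ' hδ' hg
      unfold badMass
      simp only [coupling]
      exact step_notAgr_le U β τ τ' (hΓ (i + 1) (by omega) hi) (hD (i + 1) (by omega) hi)
        (hD (i + 1) (by omega) hi) (hbd (i + 1) (by omega) hi) (hout (i + 1) (by omega) hi)
        (coupling_nonneg U β Λ τ τ' Γs Ds i) hδ' hg
    have hIcc : Finset.Icc 1 (i + 1) = insert (i + 1) (Finset.Icc 1 i) := by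
      ext j; simp [Finset.mem_Icc]; omega
    have hnot : i + 1 ∉ Finset.Icc 1 i := by simp
    by_cases hg : good (i + 1)
    · rw [hIcc, Finset.filter_insert, if_pos hg, Finset.card_insert_of_notMem (fun h => hnot
        (Finset.mem_filter.1 h).1), pow_succ, mul_comm]
      refine (hstep δ hδ0 (Or.inl ⟨rfl, hgood (i + 1) (by omega) hi hg⟩)).trans ?_
      exact mul_le_mul_of_nonneg_left IH h1δ
    · rw [hIcc, Finset.filter_insert, if_neg hg]
      refine (hstep 0 le_rfl (Or.inr rfl)).trans ?_
      rw [sub_zero, one_mul]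
      exact IH

/-- The final non-agreement mass on `Γ_n` is at most the non-agreement mass on `D_n` before the last step.
[cite: MartinelliOlivieriSchonmann1994, §2 (2.12)] -/
theorem badMass_last_le (Γs Ds : ℕ → Finset (Site d)) {n : ℕ} (hn : 1 ≤ n)
    (hΓ : ∀ i, 1 ≤ i → i ≤ n → Γs i ⊆ Λ) (hD : ∀ i, 1 ≤ i → i ≤ n → Ds (i + 1) ⊆ Γs i)
    (hbd : ∀ i, 1 ≤ i → i ≤ n → ∀ x ∈ rOuterBoundary r (Γs i), x ∈ Λ → x ∈ Ds i)
    (hout : ∀ i, 1 ≤ i → i ≤ n → ∀ x ∈ rOuterBoundary r (Γs i), x ∉ Λ → τ x = τ' x) :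
    badMass U β Λ τ τ' Γs Ds n (Γs n) ≤ badMass U β Λ τ τ' Γs Ds (n - 1) (Ds n) := by
  obtain ⟨i, rfl⟩ : ∃ i, n = i + 1 := ⟨n - 1, by omega⟩
  simp only [Nat.add_sub_cancel]
  unfold badMass
  simp only [coupling]
  have h := step_notAgr_le U β τ τ' (X := Γs (i + 1)) (hΓ (i + 1) (by omega) le_rfl)
    (hD (i + 1) (by omega) le_rfl) le_rfl
    (hbd (i + 1) (by omega) le_rfl) (hout (i + 1) (by omega) le_rfl) (coupling_nonneg U β Λ τ τ' Γs Ds i)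
    le_rfl (Or.inr rfl)
  rwa [sub_zero, one_mul] at h

/-- **The abstract surgery theorem** ([MOS94] Proposition 2.1, model-independent core): with volumes
`Γ_1 ⊇ … ⊇ Γ_n` inside `Λ`, rings `D_i ⊇ ∂_r^+Γ_i ∩ Λ` with `D_{i+1} ⊆ Γ_i`, two boundary conditions `τ, τ′`
that agree on every `∂_r^+Γ_i ∖ Λ`, and a set of GOOD steps at which the agreement mass of the next-ring
marginals is at least `δ` for every input pair, every event `E` of the spins in `Γ_n` satisfies
`|μ_Λ^τ(E) − μ_Λ^{τ′}(E)| ≤ (1 − δ)^{#good steps < n}`. [cite: MartinelliOlivieriSchonmann1994, Proposition 2.1 (proof)] -/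
theorem abs_sub_le_pow_of_scheme (Γs Ds : ℕ → Finset (Site d)) {n : ℕ} (hn : 1 ≤ n)
    (hΓ : ∀ i, 1 ≤ i → i ≤ n → Γs i ⊆ Λ)
    (hD : ∀ i, 1 ≤ i → i ≤ n → Ds (i + 1) ⊆ Γs i)
    (hbd : ∀ i, 1 ≤ i → i ≤ n → ∀ x ∈ rOuterBoundary r (Γs i), x ∈ Λ → x ∈ Ds i)
    (hout : ∀ i, 1 ≤ i → i ≤ n → ∀ x ∈ rOuterBoundary r (Γs i), x ∉ Λ → τ x = τ' x)
    {δ : ℝ} (hδ0 : 0 ≤ δ) (hδ1 : δ ≤ 1) (good : ℕ → Prop)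
    (hgood : ∀ i, 1 ≤ i → i ≤ n → good i → ∀ p : (↥Λ → S) × (↥Λ → S), ¬ AgrP (Ds i) p →
      δ ≤ ∑ m, min (qM U β τ (Γs i) (Ds (i + 1)) p.1 m) (qM U β τ' (Γs i) (Ds (i + 1)) p.2 m))
    {E : Set (Site d → S)} (hE : MeasurableSet E) (hdep : DependsOn (· ∈ E) (↑(Γs n) : Set (Site d))) :
    |(U.spec β Λ τ).real E - (U.spec β Λ τ').real E| ≤
      (1 - δ) ^ ((Finset.Icc 1 (n - 1)).filter good).card := by
  have hγ := U.isSpecification_spec β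
  haveI := hγ.isProbability Λ τ
  haveI := hγ.isProbability Λ τ'
  -- the two probabilities as expectations under the coupling `ν_n`
  have h1 : (U.spec β Λ τ).real E =
      ∑ p, coupling U β Λ τ τ' Γs Ds n p * (if glueWith Λ p.1 τ ∈ E then 1 else 0) := by
    rw [real_eq_sum_fiber Λ (U.spec β Λ τ) (hγ.proper Λ τ) hE]
    exact (coupling_marg_fst U β Λ τ τ' Γs Ds hΓ hD n le_rfl
      (fun ζ => if glueWith Λ ζ τ ∈ E then 1 else 0)).symm
  have h2 : (U.spec β Λ τ').real E =
      ∑ p, coupling U β Λ τ τ' Γs Ds n p * (if glueWith Λ p.2 τ' ∈ E then 1 else 0) := by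
    rw [real_eq_sum_fiber Λ (U.spec β Λ τ') (hγ.proper Λ τ') hE]
    exact (coupling_marg_snd U β Λ τ τ' Γs Ds hΓ hD n le_rfl
      (fun ζ => if glueWith Λ ζ τ' ∈ E then 1 else 0)).symm
  rw [h1, h2, ← Finset.sum_sub_distrib]
  -- pairs agreeing on `Γ_n` do not contribute
  have h3 : ∀ p, |coupling U β Λ τ τ' Γs Ds n p * (if glueWith Λ p.1 τ ∈ E then 1 else 0) -
      coupling U β Λ τ τ' Γs Ds n p * (if glueWith Λ p.2 τ' ∈ E then 1 else 0)|
      ≤ coupling U β Λ τ τ' Γs Ds n p * (if AgrP (Γs n) p then 0 else 1) := by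
    intro p
    have hνp : 0 ≤ coupling U β Λ τ τ' Γs Ds n p := coupling_nonneg U β Λ τ τ' Γs Ds n p
    rw [← mul_sub, abs_mul, abs_of_nonneg hνp]
    refine mul_le_mul_of_nonneg_left ?_ hνp
    by_cases hA : AgrP (Γs n) p
    · have heq : (glueWith Λ p.1 τ ∈ E) = (glueWith Λ p.2 τ' ∈ E) := by
        refine hdep fun x hx => ?_
        have hxΓ : x ∈ Γs n := Finset.mem_coe.1 hx
        have hxΛ : x ∈ Λ := hΓ n hn le_rfl hxΓ
        rw [glueWith_apply_mem Λ p.1 τ hxΛ, glueWith_apply_mem Λ p.2 τ' hxΛ]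
        exact hA ⟨x, hxΛ⟩ hxΓ
      simp only [heq, sub_self, abs_zero, if_pos hA, le_refl]
    · rw [if_neg hA]
      split_ifs <;> norm_num
  refine (Finset.abs_sum_le_sum_abs _ _).trans ((Finset.sum_le_sum fun p _ => h3 p).trans ?_)
  -- the multiscale estimate
  have h4 := badMass_last_le U β Λ τ τ' Γs Ds hn hΓ hD hbd hout
  have h5 := badMass_le_pow U β Λ τ τ' Γs Ds hΓ hD hbd hout hδ0 hδ1 good hgood (n - 1) (by omega)
  rw [show n - 1 + 1 = n by omega] at h5
  exact h4.trans h5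

end Iteration

end BoundarySurgery

end Literature.Probability.LatticeModels
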